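import Summits.FinalStateConjecture.FinalStateConjecture.Theses.EIHFluxBalance
import Summits.FinalStateConjecture.FinalStateConjecture.Theorems.EIHFluxBalanceInertialRecessionNoHoles
import Summits.FinalStateConjecture.FinalStateConjecture.Theorems.WeakCosmicCensorshipMGHD.Negative.ConstraintsLoadBearing
import Summits.FinalStateConjecture.FinalStateConjecture.Theorems.WeakCosmicCensorshipMGHD.Negative.LoadBearing
import Summits.FinalStateConjecture.FinalStateConjecture.Theorems.WeakCosmicCensorshipMGHD.Negative.LocalFamilies
import Summits.FinalStateConjecture.FinalStateConjecture.Theorems.WeakCosmicCensorshipMGHD.Negative.TruncatedMinkowski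
import Literature.Geometry.Lorentzian.TrivialDataAdmissible
import Literature.Geometry.Lorentzian.MinkowskiCauchyDevelopment
import Literature.Geometry.Lorentzian.MinkowskiGlobalHyperbolicity
import Literature.Geometry.Lorentzian.MGHDUniqueness
import Literature.Geometry.Lorentzian.HypersurfaceRestriction
import Literature.Geometry.Lorentzian.ConvergenceTransport
import Literature.Geometry.Lorentzian.CauchyDevelopmentIsometryClasses
import Summits.FinalStateConjecture.FinalStateConjecture.Theorems.WeakCosmicCensorshipTame.Negative.LoadBearing
import Summits.FinalStateConjecture.FinalStateConjecture.Theorems.WeakCosmicCensorshipTame.Negative.TameMassContinuity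
import Summits.FinalStateConjecture.FinalStateConjecture.Theorems.EIHFluxBalanceInertialRecessionLorentz
import Literature.Geometry.Lorentzian.TameGenericityDiagonal
import Literature.Geometry.Lorentzian.TameGenericityLocal
import Literature.Geometry.Lorentzian.TameBreathingCurve
import Literature.Geometry.Lorentzian.CauchyProblemProofs
import Literature.Geometry.Lorentzian.GeodesicIncompleteness

/-!
# Disproof work file — crux `ModulatedKerrHandoff` H′ (item stmt-FinalStateConjecture-17402, route
EIHFluxBalance, rank 3; the rev-6 RE-TYPING of retired 10167) — standing disprover, gen 3 / cycle 1
(`refuter-cdisprove-stmt-FinalStateConjecture-17402-0`, 2026-08-17)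

Everything below is `lean check`ed (rc 0, NO `sorry`); prose only in docstrings. This file EXTENDS the
gen-2 file (cycle 2 for 10167, 2026-08-16): §§2, 4(c)(d), 5–8, 10 are carried verbatim; §§1, 3, 4(a)(b),
9 are PORTED to the re-typed crux; §§11–14 are new. Conclusive lemmas are LANDED under
`Theorems/ModulatedKerrHandoff/Negative/`: `LoadBearing.lean` (p134193, def-free transfer lemmas +
by-name consequences) and `Readback.lean` (p134268, `HandoffN`/`HandoffProp` read-back + instances).

## WHAT CHANGED (rev 5 → rev 6, p126844): `IsChristodoulouGeneric` ↦ `IsTameChristodoulouGeneric … 1`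
(witness curves TAME on one fixed end — continuous mass, `wDist`-continuous at `0` —, IMMERSED at `0`,
injective), and the twelve-clause ansatz block gained the four HANDOFF clauses (T) eventual lab-time
causality, (O) orthochronous painted frames, (R) `RaysStayInClosure 𝒟 O`, (QS) weighted
quasi-stationarity of the painted background. H′ ⇒ H(rev 5) (`isChristodoulouGeneric_ansatzProp_of_handoff`),
so every necessary condition of the gen-2 analysis stands; the exact-Kerr BURIAL that closed 10167-as-typed
conditionally (line swallow-transfer, `Theorems/EIHFluxBalanceModulatedKerrHandoff.lean`) is no longer
a witness (`M(c) → ∞` is not tame: `not_isTameDataFamily_of_mass_tendsto_atTop`, sibling lane).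

## VERDICT (cycle 1 on H′): NO KILL — the crux RESISTS, and no kill by junk is feasible

`¬H′` (`not_modulatedKerrHandoff_iff`) needs an admissible datum `d` with `¬HandoffProp d` PROVED — an MGHD
of `d` IN HAND violating censorship / the ansatz / a handoff clause, or MGHD non-existence — AND a trap
defeating every TAME immersed injective admissible curve through `d`. The first half is not constructible
in the tree (no maximal development of any datum exists there; Minkowski maximality is unproved); the
second half got HARDER for provers (burial gone, receding-only families not immersed, §11) but not easier
for a refuter: the only new tame-continuous functional is the ADM mass (§9 item 11). All sixteen clauses are
jointly satisfiable with censorship in a genuine vacuum development of an admissible datum — Minkowski,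
`N = 0` (§7 + §12: (T), (O), (R), (QS) checked) — so no refutation comes from an internal inconsistency of
the conclusion; (O) is rigid in `t` (§13); (QS) is a genuine but satisfiable extra demand on the painted
boosts (§9 item 12).

## Index
* §1 read-back: `AnsatzN`/`Ansatz`/`AnsatzProp` (rev 5), `HandoffN`/`Handoff`/`HandoffProp` (rev 6),
  `handoffN_ansatzN`, `modulatedKerrHandoff_iff` (`Iff.rfl`), `isChristodoulouGeneric_ansatzProp_of_handoff`.
* §2 lattice (plain genericity, general `𝓓`, `P`): `isChristodoulouGeneric_mono`, `not_isChristodoulouGeneric_iff`,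
  `not_isChristodoulouGeneric_of_forall_not` / `exists_of_isChristodoulouGeneric`,
  `exists_injective_good_of_isChristodoulouGeneric`, `not_isChristodoulouGeneric_of_countable_good`; TAME
  versions: `IsTameChristodoulouGeneric.mono` (Literature), `not_isTameGeneric_iff_exists_trapped` /
  `not_isTameGeneric_of_forall_not` (sibling lane), `not_isTameGeneric_of_countable_good`. Consequences:
  `isTameGeneric_wcc_of_handoff`, `isChristodoulouGeneric_wcc_of_handoff` (H′ ⇒ typed WCC, tame and plain),
  `exists_handoffProp_of_handoff`, `exists_isMaximal_of_handoff`.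
* §3 `not_modulatedKerrHandoff_iff` (tame TRAP shape), `not_modulatedKerrHandoff_of_forall_not`,
  `modulatedKerrHandoff_iff_local` (tame local families suffice).
* §4 LOAD-BEARING HYPOTHESES: (a) `handoff_false_without_constraints`; (b) `handoffWithoutT2_false_of`;
  (c) `not_forall_development_trivialData(')` (`IsMaximal`); (d) `isSubextremal_iff_pos_and_rMinus_lt_rPlus`,
  `clause_one_iff`, `rPlus_nonpos_of_nonpos`.
* §5 `kinematics_satisfiable`; §6 `weight_fin_zero`; §7 MINKOWSKI MODEL of the twelve clauses
  (`ansatz_clauses_minkowski`, …, `conclusion_minkowski`); §8 HIDDEN EXACTNESS of (9), (11), (12).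
* §9 `regimes_note`: threat ledger (items 1–10 of gen 2; NEW 11 tameness, 12 the handoff clauses, 13 what
  would kill H′).
* §10 ISOMETRY-INVARIANCE of the twelve-clause ansatz (`ansatzN_of_isIsometricTo`, …).
* §11 (NEW) THE TAME WITNESS NOTION: `not_isImmersedAtZero_of_eventuallyEq` (receding-only families are not
  immersed), `burial_not_tame` (mass divergence is not tame), `exists_tame_selfWitness` (Literature:
  anti-vacuity of the witness notion through every admissible datum), `modulatedKerrHandoff_scale_zero`.
* §12 (NEW) THE FOUR HANDOFF CLAUSES IN THE MINKOWSKI MODEL: `clauseT_minkowski`, `clauseO_fin0`,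
  `raysStayInClosure_O₀`, `clauseQS_fin0`, `handoffN_zero_minkowski_exists`, `conclusion'_minkowski`,
  `trivialData_handoffProp_of'`.
* §13 (NEW) RIGIDITY OF (O): `clauseO_iff_at_zero` — under (3) the sign of `(Λᵢ(t)e₀)⁰` is constant, so (O)
  for all `t` is (O) at one instant; with (2), `1 ≤ (Λᵢ(t)e₀)⁰ ≤ γ`.
* §14 (NEW) `handoffN_of_isIsometricTo_of` — transport of the sixteen clauses modulo (R)-invariance.
-/

set_option linter.dupNamespace false

noncomputable section

namespace Summit.FinalStateConjecture.FinalStateConjecture.Cruxes.ModulatedKerrHandoff.Disproof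

open scoped BigOperators Topology Manifold Classical MeasureTheory Matrix InnerProductSpace ContDiff ENNReal
open Filter Set Function TopologicalSpace MeasureTheory Literature.Geometry.Lorentzian
open Summit.FinalStateConjecture.FinalStateConjecture.Theses.EIHFluxBalance
open Summit.FinalStateConjecture.FinalStateConjecture.Theorems.WeakCosmicCensorshipMGHD.Negative
open Summit.FinalStateConjecture.FinalStateConjecture.Theorems.WeakCosmicCensorshipTame.Negative
  (not_isTameGeneric_iff_exists_trapped not_isTameGeneric_of_forall_not
    isTameChristodoulouGeneric_admissible_zero tendsto_mass_of_isTameDataFamily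
    not_isTameDataFamily_of_mass_tendsto_atTop)

/-! ## §1 Read-back: the crux is curve-genericity of `HandoffProp` -/

section Readback

variable {X : Type} [TopologicalSpace X] [ChartedSpace E3 X] [IsManifold (𝓡 3) ((⊤ : ℕ∞) : WithTop ℕ∞) X]
  [ConnectedSpace X] {D : InitialDataSet (𝓡 3) X}

/-- The MODULATED MULTI-KERR–SCHILD ANSATZ with a fixed number `N` of holes, for a vacuum Cauchy
development `𝒟` (verbatim the crux text with `∃ N` pulled out; literally the `Antecedent` of the
sibling crux `InertialRecession`). -/
def AnsatzN (𝒟 : VacuumCauchyDevelopment D) (N : ℕ) : Prop :=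
  ∃ (M a rin : Fin N → ℝ) (Λ : Fin N → ℝ → lorentzGroup) (ξ : Fin N → ℝ → E3) (γ κ τ₀ : ℝ) (U : Opens E4) (Φ : U → 𝒟.carrier) (O : Set 𝒟.carrier), (∀ i, Kerr.IsSubextremal (M i) (a i) ∧ Kerr.rMinus (M i) (a i) < rin i ∧ rin i < Kerr.rPlus (M i) (a i)) ∧ (∀ i t, |((Λ i t : E4 ≃L[ℝ] E4) (E4.basisVector 0)) 0| ≤ γ) ∧ (∀ i, ContDiff ℝ ((⊤ : ℕ∞) : WithTop ℕ∞) (ξ i) ∧ ContDiff ℝ ((⊤ : ℕ∞) : WithTop ℕ∞) (fun t ↦ ((Λ i t : E4 ≃L[ℝ] E4) : E4 →L[ℝ] E4))) ∧ (∀ i j, i ≠ j → Tendsto (fun t ↦ ‖ξ i t - ξ j t‖) atTop atTop) ∧ (0 < κ ∧ κ < 1 ∧ ∀ i, ∀ᶠ t in atTop, ‖ξ i t‖ ≤ κ ^ 2 * t) ∧ ({x : E4 | τ₀ < x 0 ∧ ∀ i, rin i < Kerr.radius (a i) (poincareInv (Λ i (x 0)) (E4.ofTimeSpace (x 0) (ξ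 i (x 0))) x)} ⊆ (U : Set E4)) ∧ let B : ModelBackground := ⟨U, fun x ↦ Minkowski.bilin + ∑ i, (boostedKerrBilin (Λ i (x 0)) (E4.ofTimeSpace (x 0) (ξ i (x 0))) (M i) (a i) x - Minkowski.bilin), fun x ↦ x 0, E4.spatialNorm⟩; ContMDiff 𝓘(ℝ, E4) (𝓡 4) ((⊤ : ℕ∞) : WithTop ℕ∞) Φ ∧ Topology.IsOpenEmbedding ((B.lateRegion τ₀).restrict Φ) ∧ Φ '' {x : U | τ₀ < x.1 0 ∧ ∀ i, Kerr.rPlus (M i) (a i) < Kerr.radius (a i) (poincareInv (Λ i (x.1 0)) (E4.ofTimeSpace (x.1 0) (ξ i (x.1 0))) x.1)} ⊆ O ∧ Tendsto (fun t ↦ 𝒟.toSpacetime.deviationCk B Φ 3 t) atTop (𝓝 0) ∧ Tendsto (fun t : ℝ ↦ ⨆ x ∈ {x : U | x.1 0 = t ∧ E4.spatialNorm x.1 ≤ κ * t}, ⨆ (m : ℕ) (_ : m ≤ 3), ENNReal.ofReal (1 + √(√((⨅ i, ‖E4.spatial x.1 - ξ i t‖) ^ 7))) * ‖iteratedFDeriv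 ℝ m (𝒟.toSpacetime.deviationExtend B Φ) x.1‖ₑ) atTop (𝓝 0) ∧ O = Summit.FinalStateConjecture.exteriorOf 𝒟.toCauchyDevelopment (Φ '' {x : U | τ₀ < x.1 0 ∧ ∀ i, Kerr.rPlus (M i) (a i) < Kerr.radius (a i) (poincareInv (Λ i (x.1 0)) (E4.ofTimeSpace (x.1 0) (ξ i (x.1 0))) x.1)}) ∧ ∀ t₁ : ℝ, τ₀ < t₁ → O \ Φ '' {x : U | t₁ < x.1 0 ∧ ∀ i, Kerr.rPlus (M i) (a i) < Kerr.radius (a i) (poincareInv (Λ i (x.1 0)) (E4.ofTimeSpace (x.1 0) (ξ i (x.1 0))) x.1)} ⊆ 𝒟.metric.causalPast 𝒟.timeOrientation (Φ '' {x : U | x.1 0 = t₁ ∧ ∀ i, Kerr.rPlus (M i) (a i) < Kerr.radius (a i) (poincareInv (Λ i (x.1 0)) (E4.ofTimeSpace (x.1 0) (ξ i (x.1 0))) x.1)})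

/-- The twelve-clause ansatz of rev 5: some number of holes. -/
def Ansatz (𝒟 : VacuumCauchyDevelopment D) : Prop :=
  ∃ N, AnsatzN 𝒟 N

-- operator-norm instance paths on form-valued maps are slow to unify (clause (QS))
set_option synthInstance.maxHeartbeats 400000 in
/-- The MODULATED MULTI-KERR–SCHILD ANSATZ **WITH HANDOFF**, `N` holes (rev 6): verbatim the
`∃`-block of H′ with `∃ N` pulled out (literally the antecedent of the sibling crux `InertialRecession`
E′, item 17403): the twelve clauses of `AnsatzN` followed, inside the same `let B`, by (T) eventual
lab-time causality of the charted region `{x⁰ > τ₁, rᵢ > rinᵢ}`, (O) orthochronous painted frames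
`0 < (Λᵢ(t)e₀)⁰`, (R) `RaysStayInClosure 𝒟 O`, (QS) weighted quasi-stationarity of the painted
background. (Read-back landed as `Theorems/ModulatedKerrHandoff/Negative/Readback.lean`, p134268.) -/
def HandoffN (𝒟 : VacuumCauchyDevelopment D) (N : ℕ) : Prop :=
  ∃ (M a rin : Fin N → ℝ) (Λ : Fin N → ℝ → lorentzGroup) (ξ : Fin N → ℝ → E3) (γ κ τ₀ : ℝ) (U : Opens E4) (Φ : U → 𝒟.carrier) (O : Set 𝒟.carrier), (∀ i, Kerr.IsSubextremal (M i) (a i) ∧ Kerr.rMinus (M i) (a i) < rin i ∧ rin i < Kerr.rPlus (M i) (a i)) ∧ (∀ i t, |((Λ i t : E4 ≃L[ℝ] E4) (E4.basisVector 0)) 0| ≤ γ) ∧ (∀ i, ContDiff ℝ ((⊤ : ℕ∞) : WithTop ℕ∞) (ξ i) ∧ ContDiff ℝ ((⊤ : ℕ∞) : WithTop ℕ∞) (fun t ↦ ((Λ i t : E4 ≃L[ℝ] E4) : E4 →L[ℝ] E4))) ∧ (∀ i j, i ≠ j → Tendsto (fun t ↦ ‖ξ i t - ξ j t‖) atTop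 atTop) ∧ (0 < κ ∧ κ < 1 ∧ ∀ i, ∀ᶠ t in atTop, ‖ξ i t‖ ≤ κ ^ 2 * t) ∧ ({x : E4 | τ₀ < x 0 ∧ ∀ i, rin i < Kerr.radius (a i) (poincareInv (Λ i (x 0)) (E4.ofTimeSpace (x 0) (ξ i (x 0))) x)} ⊆ (U : Set E4)) ∧ let B : ModelBackground := ⟨U, fun x ↦ Minkowski.bilin + ∑ i, (boostedKerrBilin (Λ i (x 0)) (E4.ofTimeSpace (x 0) (ξ i (x 0))) (M i) (a i) x - Minkowski.bilin), fun x ↦ x 0, E4.spatialNorm⟩; ContMDiff 𝓘(ℝ, E4) (𝓡 4) ((⊤ : ℕ∞) : WithTop ℕ∞) Φ ∧ Topology.IsOpenEmbedding ((B.lateRegion τ₀).restrict Φ) ∧ Φ '' {x : U | τ₀ < x.1 0 ∧ ∀ i, Kerr.rPlus (M i) (a i) < Kerr.radius (a i) (poincareInv (Λ i (x.1 0)) (E4.ofTimeSpace (x.1 0) (ξ i (x.1 0))) x.1)} ⊆ O ∧ Tendsto (fun t ↦ 𝒟.toSpacetime.deviationCk B Φ 3 t) atTop (𝓝 0) ∧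 Tendsto (fun t : ℝ ↦ ⨆ x ∈ {x : U | x.1 0 = t ∧ E4.spatialNorm x.1 ≤ κ * t}, ⨆ (m : ℕ) (_ : m ≤ 3), ENNReal.ofReal (1 + √(√((⨅ i, ‖E4.spatial x.1 - ξ i t‖) ^ 7))) * ‖iteratedFDeriv ℝ m (𝒟.toSpacetime.deviationExtend B Φ) x.1‖ₑ) atTop (𝓝 0) ∧ O = Summit.FinalStateConjecture.exteriorOf 𝒟.toCauchyDevelopment (Φ '' {x : U | τ₀ < x.1 0 ∧ ∀ i, Kerr.rPlus (M i) (a i) < Kerr.radius (a i) (poincareInv (Λ i (x.1 0)) (E4.ofTimeSpace (x.1 0) (ξ i (x.1 0))) x.1)}) ∧ (∀ t₁ : ℝ, τ₀ < t₁ → O \ Φ '' {x : U | t₁ < x.1 0 ∧ ∀ i, Kerr.rPlus (M i) (a i) < Kerr.radius (a i) (poincareInv (Λ i (x.1 0)) (E4.ofTimeSpace (x.1 0) (ξ i (x.1 0))) x.1)} ⊆ 𝒟.metric.causalPast 𝒟.timeOrientation (Φ '' {x : U | x.1 0 = t₁ ∧ ∀ i, Kerr.rPlus (M i) (a i) < Kerr.radius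 (a i) (poincareInv (Λ i (x.1 0)) (E4.ofTimeSpace (x.1 0) (ξ i (x.1 0))) x.1)})) ∧ (∃ τ₁ : ℝ, ∀ x y : U, (τ₁ < x.1 0 ∧ ∀ i, rin i < Kerr.radius (a i) (poincareInv (Λ i (x.1 0)) (E4.ofTimeSpace (x.1 0) (ξ i (x.1 0))) x.1)) → (τ₁ < y.1 0 ∧ ∀ i, rin i < Kerr.radius (a i) (poincareInv (Λ i (y.1 0)) (E4.ofTimeSpace (y.1 0) (ξ i (y.1 0))) y.1)) → Φ y ∈ 𝒟.metric.causalFuture 𝒟.timeOrientation {Φ x} → x.1 0 ≤ y.1 0) ∧ (∀ (i : Fin N) (t : ℝ), 0 < (((Λ i t : lorentzGroup) : E4 ≃L[ℝ] E4) (E4.basisVector 0)) 0) ∧ Summit.FinalStateConjecture.RaysStayInClosure 𝒟.toCauchyDevelopment O ∧ (∀ ρ : ℝ → ℝ, Tendsto ρ atTop atTop → Tendsto (fun t : ℝ ↦ ⨆ x ∈ {x : E4 | x 0 = t ∧ E4.spatialNorm x ≤ κ * t ∧ ρ t ≤ ⨅ i, ‖E4.spatial x - ξ i t‖}, ENNReal.ofReal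 (1 + √(√((⨅ i, ‖E4.spatial x - ξ i t‖) ^ 7))) * ‖fderiv ℝ (fun y : E4 ↦ Minkowski.bilin + ∑ i, (boostedKerrBilin (Λ i (y 0)) (E4.ofTimeSpace (y 0) (ξ i (y 0))) (M i) (a i) y - Minkowski.bilin)) x (E4.basisVector 0)‖ₑ) atTop (𝓝 0))

/-- The ansatz-with-handoff clause of H′: some number of holes. -/
def Handoff (𝒟 : VacuumCauchyDevelopment D) : Prop :=
  ∃ N, HandoffN 𝒟 N

/-- Dropping the four handoff clauses: the sixteen-clause block refines the twelve-clause block. -/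
theorem handoffN_ansatzN {𝒟 : VacuumCauchyDevelopment D} {N : ℕ} (h : HandoffN 𝒟 N) : AnsatzN 𝒟 N := by
  obtain ⟨M, a, rin, Λ, ξ, γ, κ, τ₀, U, Φ, O, h1, h2, h3, h4, h5, hU, hB⟩ := h
  obtain ⟨hΦ, hemb, himO, hdev, hwt, hO, hexh, -, -, -, -⟩ := hB
  exact ⟨M, a, rin, Λ, ξ, γ, κ, τ₀, U, Φ, O, h1, h2, h3, h4, h5, hU, hΦ, hemb, himO, hdev, hwt, hO, hexh⟩

theorem Handoff.ansatz {𝒟 : VacuumCauchyDevelopment D} (h : Handoff 𝒟) : Ansatz 𝒟 :=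
  let ⟨N, hN⟩ := h; ⟨N, handoffN_ansatzN hN⟩

variable (X) in
/-- The rev-5 property (retired crux 10167): an MGHD exists, and every MGHD has complete `𝓘⁺`
(sojourn form) AND is asymptotic to a modulated multi-Kerr–Schild ansatz (twelve clauses). -/
def AnsatzProp (D : InitialDataSet (𝓡 3) X) : Prop :=
  (∃ 𝒟 : VacuumCauchyDevelopment D, 𝒟.IsMaximal) ∧
    ∀ 𝒟 : VacuumCauchyDevelopment D, 𝒟.IsMaximal →
      Summit.FinalStateConjecture.HasCompleteNullInfinity 𝒟.toCauchyDevelopment ∧ Ansatz 𝒟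

variable (X) in
/-- The rev-6 property whose TAME Christodoulou-genericity the crux H′ asserts: an MGHD exists, and
every MGHD has complete `𝓘⁺` (sojourn form) AND carries the ansatz with handoff (sixteen clauses). -/
def HandoffProp (D : InitialDataSet (𝓡 3) X) : Prop :=
  (∃ 𝒟 : VacuumCauchyDevelopment D, 𝒟.IsMaximal) ∧
    ∀ 𝒟 : VacuumCauchyDevelopment D, 𝒟.IsMaximal →
      Summit.FinalStateConjecture.HasCompleteNullInfinity 𝒟.toCauchyDevelopment ∧ Handoff 𝒟

/-- `HandoffProp` refines `AnsatzProp` pointwise. -/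
theorem ansatzProp_of_handoffProp {D : InitialDataSet (𝓡 3) X} (h : HandoffProp X D) : AnsatzProp X D :=
  ⟨h.1, fun 𝒟 h𝒟 ↦ ⟨(h.2 𝒟 h𝒟).1, (h.2 𝒟 h𝒟).2.ansatz⟩⟩

variable (X) in
/-- The weak-cosmic-censorship property of the sibling crux `WeakCosmicCensorshipMGHD`
(route PhaseMixingCapture, item 9952), written out (that route's Theses file is not imported). -/
def WCCProp (D : InitialDataSet (𝓡 3) X) : Prop :=
  (∃ 𝒟 : VacuumCauchyDevelopment D, 𝒟.IsMaximal) ∧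
    ∀ 𝒟 : VacuumCauchyDevelopment D, 𝒟.IsMaximal →
      Summit.FinalStateConjecture.HasCompleteNullInfinity 𝒟.toCauchyDevelopment

/-- `AnsatzProp` refines `WCCProp` pointwise. -/
theorem wccProp_of_ansatzProp {D : InitialDataSet (𝓡 3) X} (h : AnsatzProp X D) : WCCProp X D :=
  ⟨h.1, fun 𝒟 h𝒟 ↦ (h.2 𝒟 h𝒟).1⟩

/-- `HandoffProp` refines `WCCProp` pointwise. -/
theorem wccProp_of_handoffProp {D : InitialDataSet (𝓡 3) X} (h : HandoffProp X D) : WCCProp X D :=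
  ⟨h.1, fun 𝒟 h𝒟 ↦ (h.2 𝒟 h𝒟).1⟩

end Readback

/-- FAITHFULNESS: the crux H′ is literally
`∀ Σ, IsTameChristodoulouGeneric (admissibleVacuumData Σ) HandoffProp 1`. -/
theorem modulatedKerrHandoff_iff :
    ModulatedKerrHandoff ↔
      ∀ (X : Type) [TopologicalSpace X] [ChartedSpace E3 X]
        [IsManifold (𝓡 3) ((⊤ : ℕ∞) : WithTop ℕ∞) X] [T2Space X] [SecondCountableTopology X]
        [ConnectedSpace X],
        InitialDataSet.IsTameChristodoulouGeneric (admissibleVacuumData X) (HandoffProp X) 1 :=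
  Iff.rfl

/-- **H′ ⇒ H (rev 5)**: tame genericity of `HandoffProp` gives plain genericity of `AnsatzProp`
(monotonicity in the property, then forget tameness). Every necessary condition of the gen-2 analysis
of the retired crux therefore binds H′. -/
theorem isChristodoulouGeneric_ansatzProp_of_handoff (h : ModulatedKerrHandoff) (X : Type)
    [TopologicalSpace X] [ChartedSpace E3 X] [IsManifold (𝓡 3) ((⊤ : ℕ∞) : WithTop ℕ∞) X] [T2Space X]
    [SecondCountableTopology X] [ConnectedSpace X] :
    InitialDataSet.IsChristodoulouGeneric (admissibleVacuumData X) (AnsatzProp X) 1 :=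
  ((h X).mono fun _ _ ↦ ansatzProp_of_handoffProp).isChristodoulouGeneric

/-! ## §2 Lattice: genericity is monotone in the property; the crux implies typed WCC -/

section Lattice

variable {E : Type*} [NormedAddCommGroup E] [NormedSpace ℝ E] {H : Type*} [TopologicalSpace H]
  {I : ModelWithCorners ℝ E H} {X : Type*} [TopologicalSpace X] [ChartedSpace H X]
  [IsManifold I ∞ X]

/-- Curve-genericity is MONOTONE in the property (the glue of the route's Assembly). -/
theorem isChristodoulouGeneric_mono {𝓓 : Set (InitialDataSet I X)} {P Q : InitialDataSet I X → Prop}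
    (hPQ : ∀ d ∈ 𝓓, P d → Q d) {m : ℕ} (h : InitialDataSet.IsChristodoulouGeneric 𝓓 P m) :
    InitialDataSet.IsChristodoulouGeneric 𝓓 Q m := by
  intro d hd
  obtain ⟨F, hF, h0, hinj, hD, hgood⟩ := h d ⟨hd.1, fun hP ↦ hd.2 (hPQ d hd.1 hP)⟩
  exact ⟨F, hF, h0, hinj, hD, fun c hc hmem ↦ hgood c hc ⟨hmem.1, fun hP ↦ hmem.2 (hPQ _ hmem.1 hP)⟩⟩

/-- EXACT SHAPE OF A REFUTATION of codimension-`1` genericity: one exceptional admissible datum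
through which EVERY jointly smooth injective admissible curve meets the exceptional set again at a
nonzero parameter. -/
theorem not_isChristodoulouGeneric_iff {𝓓 : Set (InitialDataSet I X)} {P : InitialDataSet I X → Prop}
    {m : ℕ} :
    ¬ InitialDataSet.IsChristodoulouGeneric 𝓓 P m ↔
      ∃ d ∈ 𝓓, ¬ P d ∧ ∀ F : EuclideanSpace ℝ (Fin m) → InitialDataSet I X,
        InitialDataSet.IsSmoothDataFamily m F → F 0 = d → Injective F → (∀ c, F c ∈ 𝓓) →
          ∃ c ≠ 0, ¬ P (F c) := by
  constructor
  · intro h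
    by_contra hcon
    apply h
    intro d hd
    by_contra hnoF
    apply hcon
    refine ⟨d, hd.1, hd.2, fun F hF h0 hinj hD ↦ ?_⟩
    by_contra hc
    push Not at hc
    exact hnoF ⟨F, hF, h0, hinj, hD, fun c hc' hmem ↦ hmem.2 (hc c hc')⟩
  · rintro ⟨d, hd, hP, h⟩ hgen
    obtain ⟨F, hF, h0, hinj, hD, hgood⟩ := hgen d ⟨hd, hP⟩
    obtain ⟨c, hc, hPc⟩ := h F hF h0 hinj hD
    exact hgood c hc ⟨hD c, hPc⟩

/-- `ℝ¹` has a nonzero vector. -/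
theorem euclideanSpace_one_exists_ne_zero : ∃ c : EuclideanSpace ℝ (Fin 1), c ≠ 0 :=
  ⟨EuclideanSpace.single 0 1, fun h ↦ by simpa using congrArg (fun c : EuclideanSpace ℝ (Fin 1) ↦ c 0) h⟩

/-- A NONEMPTY admissible class all of whose members are exceptional is NOT codim-`1` generic
(the curve through an exceptional datum stays admissible, hence exceptional). -/
theorem not_isChristodoulouGeneric_of_forall_not {𝓓 : Set (InitialDataSet I X)}
    {P : InitialDataSet I X → Prop} (hne : 𝓓.Nonempty) (hall : ∀ d ∈ 𝓓, ¬ P d) :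
    ¬ InitialDataSet.IsChristodoulouGeneric 𝓓 P 1 := by
  obtain ⟨d, hd⟩ := hne
  intro h
  obtain ⟨F, -, -, -, hD, hgood⟩ := h d ⟨hd, hall d hd⟩
  obtain ⟨c, hc⟩ := euclideanSpace_one_exists_ne_zero
  exact hgood c hc ⟨hD c, hall _ (hD c)⟩

/-- Dually, codim-`1` genericity on a nonempty class produces a GOOD admissible datum. -/
theorem exists_of_isChristodoulouGeneric {𝓓 : Set (InitialDataSet I X)}
    {P : InitialDataSet I X → Prop} (h : InitialDataSet.IsChristodoulouGeneric 𝓓 P 1)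
    (hne : 𝓓.Nonempty) : ∃ d ∈ 𝓓, P d := by
  by_contra hcon
  push Not at hcon
  exact not_isChristodoulouGeneric_of_forall_not hne hcon h

/-- Codim-`1` genericity and ONE exceptional datum give an injective curve of good data missing
only the parameter `0`: the good set is then uncountable (it contains a copy of `ℝ ∖ {0}`). -/
theorem exists_injective_good_of_isChristodoulouGeneric {𝓓 : Set (InitialDataSet I X)}
    {P : InitialDataSet I X → Prop} (h : InitialDataSet.IsChristodoulouGeneric 𝓓 P 1)
    {d : InitialDataSet I X} (hd : d ∈ 𝓓) (hP : ¬ P d) :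
    ∃ F : EuclideanSpace ℝ (Fin 1) → InitialDataSet I X, Injective F ∧ F 0 = d ∧
      ∀ c ≠ 0, F c ∈ 𝓓 ∧ P (F c) := by
  obtain ⟨F, -, h0, hinj, hD, hgood⟩ := h d ⟨hd, hP⟩
  refine ⟨F, hinj, h0, fun c hc ↦ ⟨hD c, ?_⟩⟩
  by_contra hPc
  exact hgood c hc ⟨hD c, hPc⟩

/-- COUNTABLE-GOOD-SET CRITERION: if the good admissible data form a countable set while some
admissible datum is exceptional, codim-`1` genericity fails (an injective curve of good data would
embed the uncountable `ℝ¹ ∖ {0}` into a countable set). -/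
theorem not_isChristodoulouGeneric_of_countable_good {𝓓 : Set (InitialDataSet I X)}
    {P : InitialDataSet I X → Prop} (hcount : {d ∈ 𝓓 | P d}.Countable)
    {d : InitialDataSet I X} (hd : d ∈ 𝓓) (hP : ¬ P d) :
    ¬ InitialDataSet.IsChristodoulouGeneric 𝓓 P 1 := by
  intro h
  obtain ⟨F, hinj, -, hgood⟩ := exists_injective_good_of_isChristodoulouGeneric h hd hP
  have hsub : F '' {c | c ≠ 0} ⊆ {d ∈ 𝓓 | P d} := by
    rintro _ ⟨c, hc, rfl⟩
    exact hgood c hc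
  have hc1 : ({c : EuclideanSpace ℝ (Fin 1) | c ≠ 0}).Countable :=
    ((hcount.mono hsub).preimage_of_injOn hinj.injOn).mono (subset_preimage_image _ _)
  have hc2 : (univ : Set (EuclideanSpace ℝ (Fin 1))).Countable := by
    have : (univ : Set (EuclideanSpace ℝ (Fin 1))) = {c | c ≠ 0} ∪ {0} := by
      ext c; by_cases hc : c = 0 <;> simp [hc]
    rw [this]
    exact hc1.union (countable_singleton 0)
  have hR : (univ : Set ℝ) ⊆ (fun c : EuclideanSpace ℝ (Fin 1) ↦ c 0) '' univ := fun r _ ↦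
    ⟨EuclideanSpace.single 0 r, mem_univ _, by simp⟩
  exact Cardinal.not_countable_real ((hc2.image _).mono hR)

end Lattice

section Consequences

variable {X : Type} [TopologicalSpace X] [ChartedSpace E3 X] [IsManifold (𝓡 3) ((⊤ : ℕ∞) : WithTop ℕ∞) X]
  [T2Space X] [SecondCountableTopology X] [ConnectedSpace X]

/-- TAME COUNTABLE-GOOD-SET CRITERION (the tame witness curves are in particular jointly smooth
injective admissible curves, so the plain criterion applies verbatim). -/
theorem not_isTameGeneric_of_countable_good {Y : Type} [TopologicalSpace Y] [ChartedSpace E3 Y]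
    [IsManifold (𝓡 3) ((⊤ : ℕ∞) : WithTop ℕ∞) Y] {𝓓 : Set (InitialDataSet (𝓡 3) Y)}
    {P : InitialDataSet (𝓡 3) Y → Prop} (hcount : {d ∈ 𝓓 | P d}.Countable)
    {d : InitialDataSet (𝓡 3) Y} (hd : d ∈ 𝓓) (hP : ¬ P d) :
    ¬ InitialDataSet.IsTameChristodoulouGeneric 𝓓 P 1 :=
  fun h ↦ not_isChristodoulouGeneric_of_countable_good hcount hd hP h.isChristodoulouGeneric

variable (X) in
/-- THE CRUX IMPLIES **TAME** TYPED WEAK COSMIC CENSORSHIP, `Σ` by `Σ` (monotonicity of tame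
genericity in the property): a kill of the sibling crux `WeakCosmicCensorshipTame` (17269) — or of the
summit's censorship content — kills H′; conversely nothing weaker than tame-generic censorship + MGHD
existence can prove it. (Landed by name: `Negative/LoadBearing.lean`,
`isTameGeneric_censored_of_modulatedKerrHandoff`, p134193.) -/
theorem isTameGeneric_wcc_of_handoff (h : ModulatedKerrHandoff) :
    InitialDataSet.IsTameChristodoulouGeneric (admissibleVacuumData X) (WCCProp X) 1 :=
  (h X).mono fun _ _ ↦ wccProp_of_handoffProp

variable (X) in
/-- … and a fortiori PLAIN typed weak cosmic censorship (sibling crux `WeakCosmicCensorshipMGHD`, 9952). -/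
theorem isChristodoulouGeneric_wcc_of_handoff (h : ModulatedKerrHandoff) :
    InitialDataSet.IsChristodoulouGeneric (admissibleVacuumData X) (WCCProp X) 1 :=
  (isTameGeneric_wcc_of_handoff X h).isChristodoulouGeneric

/-- EXISTENTIAL CONTENT: H′ implies that SOME admissible datum on `ℝ³` has a maximal vacuum Cauchy
development, all of whose MGHDs have complete `𝓘⁺` and the sixteen-clause package (the admissible
class of `ℝ³` is nonempty, `trivialData_mem_admissibleVacuumData`; a nonempty class of exceptional
data is not tame-generic, `not_isTameGeneric_of_forall_not`). So MGHD theory AND the asymptotic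
analysis are load-bearing: no proof by bookkeeping. -/
theorem exists_handoffProp_of_handoff (h : ModulatedKerrHandoff) :
    ∃ D ∈ admissibleVacuumData Minkowski.slice, HandoffProp Minkowski.slice D := by
  by_contra hcon
  push Not at hcon
  exact not_isTameGeneric_of_forall_not _ trivialData_mem_admissibleVacuumData hcon (h Minkowski.slice)

/-- In particular the crux implies an instance of Choquet-Bruhat–Geroch MGHD EXISTENCE (unproved in
the tree: `choquetBruhat_geroch_exists_mghd_cauchy` is a named fact, not a theorem). -/
theorem exists_isMaximal_of_handoff (h : ModulatedKerrHandoff) :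
    ∃ D ∈ admissibleVacuumData Minkowski.slice, ∃ 𝒟 : VacuumCauchyDevelopment D, 𝒟.IsMaximal := by
  obtain ⟨D, hD, hP⟩ := exists_handoffProp_of_handoff h
  exact ⟨D, hD, hP.1⟩

end Consequences

/-! ## §3 What a refutation must look like -/

/-- EXACT SHAPE OF `¬H′`: a data manifold `Σ`, an exceptional admissible datum `d` on it, and a
TAME TRAP — every tame (on some end), immersed, injective admissible curve through `d` is exceptional
again at some nonzero parameter. Both halves are out of reach in the tree: `¬ HandoffProp d` needs an
MGHD of `d` IN HAND violating censorship / asymptotics / a handoff clause (or MGHD non-existence), and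
the trap must defeat COMPOSITE tame witnesses (local first-order cure ⊕ Kerr-end trimming at a free
receding radius; §11, `regimes_note` items 11, 13). (Landed: `Negative/Readback.lean`.) -/
theorem not_modulatedKerrHandoff_iff :
    ¬ ModulatedKerrHandoff ↔
      ∃ (X : Type) (_ : TopologicalSpace X) (_ : ChartedSpace E3 X)
        (_ : IsManifold (𝓡 3) ((⊤ : ℕ∞) : WithTop ℕ∞) X) (_ : T2Space X) (_ : SecondCountableTopology X)
        (_ : ConnectedSpace X),
        ∃ d ∈ admissibleVacuumData X, ¬ HandoffProp X d ∧
          ∀ (e : AFEnd X) (F : EuclideanSpace ℝ (Fin 1) → InitialDataSet (𝓡 3) X),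
            InitialDataSet.IsTameDataFamily e 1 F → InitialDataSet.IsImmersedAtZero 1 F → F 0 = d →
              Injective F → (∀ c, F c ∈ admissibleVacuumData X) → ∃ c, c ≠ 0 ∧ ¬ HandoffProp X (F c) := by
  rw [modulatedKerrHandoff_iff]
  simp only [not_forall]
  constructor
  · rintro ⟨X, i1, i2, i3, i4, i5, i6, h⟩
    exact ⟨X, i1, i2, i3, i4, i5, i6, (not_isTameGeneric_iff_exists_trapped _).1 h⟩
  · rintro ⟨X, i1, i2, i3, i4, i5, i6, h⟩
    exact ⟨X, i1, i2, i3, i4, i5, i6, (not_isTameGeneric_iff_exists_trapped _).2 h⟩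

/-- SUFFICIENT FOR A KILL (pointwise form): a data manifold carrying admissible data ALL of which are
exceptional. On `ℝ³` this reads: if NO admissible datum on `ℝ³` has the handoff property, the crux
is false (`admissibleVacuumData Minkowski.slice ∋ trivialData`). -/
theorem not_modulatedKerrHandoff_of_forall_not
    (h : ∀ D ∈ admissibleVacuumData Minkowski.slice, ¬ HandoffProp Minkowski.slice D) :
    ¬ ModulatedKerrHandoff := fun hH ↦
  not_isTameGeneric_of_forall_not _ trivialData_mem_admissibleVacuumData h (hH Minkowski.slice)

/-- TAME LOCAL FAMILIES SUFFICE (`isTameChristodoulouGeneric_of_local`, Literature): provers need only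
tame immersed injective admissible curves whose members with `0 < ‖c‖ < ε` are good; a refuter must trap
every such curve ARBITRARILY CLOSE to `c = 0` — which is why only functionals of the datum that are
continuous along tame curves at `0` (jets on compacta; the ADM mass) can build a trap (§9 item 13). -/
theorem modulatedKerrHandoff_iff_local :
    ModulatedKerrHandoff ↔
      ∀ (X : Type) [TopologicalSpace X] [ChartedSpace E3 X]
        [IsManifold (𝓡 3) ((⊤ : ℕ∞) : WithTop ℕ∞) X] [T2Space X] [SecondCountableTopology X]
        [ConnectedSpace X], ∀ d ∈ admissibleVacuumData X, ¬ HandoffProp X d →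
          ∃ (e : AFEnd X) (F : EuclideanSpace ℝ (Fin 1) → InitialDataSet (𝓡 3) X),
            InitialDataSet.IsTameDataFamily e 1 F ∧ InitialDataSet.IsImmersedAtZero 1 F ∧ F 0 = d ∧
              Injective F ∧ (∀ c, F c ∈ admissibleVacuumData X) ∧
                ∃ ε > (0 : ℝ), ∀ c, c ≠ 0 → ‖c‖ < ε → HandoffProp X (F c) := by
  rw [modulatedKerrHandoff_iff]
  refine forall_congr' fun X ↦ forall_congr' fun _ ↦ forall_congr' fun _ ↦ forall_congr' fun _ ↦
    forall_congr' fun _ ↦ forall_congr' fun _ ↦ forall_congr' fun _ ↦ ⟨fun h d hd hP ↦ ?_, fun h ↦ ?_⟩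
  · obtain ⟨e, F, hF, himm, h0, hinj, hD, hgood⟩ := h d ⟨hd, hP⟩
    refine ⟨e, F, hF, himm, h0, hinj, hD, 1, one_pos, fun c hc _ ↦ ?_⟩
    by_contra hPc
    exact hgood c hc ⟨hD c, hPc⟩
  · exact InitialDataSet.isTameChristodoulouGeneric_of_local fun d hd hP ↦ h d hd hP


/-! ## §4 Load-bearing hypotheses of the crux (mutation analysis) -/

section LoadBearing

/-- (a) THE VACUUM-CONSTRAINT CLAUSE OF ADMISSIBILITY IS LOAD-BEARING: H′ with
`D.IsVacuumConstraintSolution` deleted from the admissible class (everything else verbatim;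
`admissibleNoConstraint` of the sibling seat 9952) is FALSE. It refines the constraint-free WCC
statement, which fails at the trapped datum `bumpData = (ℝ³, δ, ψ(|y|²)δ)` (Hamiltonian constraint
`6` at the origin, continuous along smooth curves; `wcc_false_without_constraints`); tame genericity is
monotone in the property and forgets to plain genericity. (Landed: `Negative/Readback.lean`
`modulatedKerrHandoff_false_without_constraints`; general-`P` form `Negative/LoadBearing.lean`
`not_isTameGeneric_noConstraint_of_needsDevelopment`.) -/
theorem handoff_false_without_constraints :
    ¬ ∀ (X : Type) [TopologicalSpace X] [ChartedSpace E3 X]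
      [IsManifold (𝓡 3) ((⊤ : ℕ∞) : WithTop ℕ∞) X] [T2Space X] [SecondCountableTopology X] [ConnectedSpace X],
      InitialDataSet.IsTameChristodoulouGeneric (admissibleNoConstraint X) (HandoffProp X) 1 :=
  fun h ↦ wcc_false_without_constraints fun X _ _ _ _ _ _ ↦
    ((h X).mono fun _ _ hP ↦ wccProp_of_handoffProp hP).isChristodoulouGeneric

/-- (b) `[T2Space Σ]` IS LOAD-BEARING (degenerately): the `T2`-free crux is false as soon as ONE
non-Hausdorff connected second-countable `3`-manifold carries an admissible datum (e.g. `ℝ³` with a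
doubled origin and the flat data; not constructed in the tree): on such a `Σ` no datum has a data
embedding into a (Hausdorff) spacetime (`isEmpty_vacuumCauchyDevelopment_of_not_t2Space`), so every
datum is exceptional and no curve escapes. (Landed: `Negative/Readback.lean`, `Negative/LoadBearing.lean`.) -/
theorem handoffWithoutT2_false_of
    (H : ∃ (Y : Type) (_ : TopologicalSpace Y) (_ : ChartedSpace E3 Y)
      (_ : IsManifold (𝓡 3) ((⊤ : ℕ∞) : WithTop ℕ∞) Y)
      (_ : SecondCountableTopology Y) (_ : ConnectedSpace Y),
      ¬ T2Space Y ∧ (admissibleVacuumData Y).Nonempty) :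
    ¬ ∀ (X : Type) [TopologicalSpace X] [ChartedSpace E3 X]
      [IsManifold (𝓡 3) ((⊤ : ℕ∞) : WithTop ℕ∞) X] [SecondCountableTopology X] [ConnectedSpace X],
      InitialDataSet.IsTameChristodoulouGeneric (admissibleVacuumData X) (HandoffProp X) 1 :=
  fun h ↦ wccWithoutT2_false_of H fun X _ _ _ _ _ ↦
    ((h X).mono fun _ _ hP ↦ wccProp_of_handoffProp hP).isChristodoulouGeneric

/-- (c) `IsMaximal` IN THE `∀`-CLAUSE IS LOAD-BEARING: asking the conclusion of EVERY vacuum Cauchy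
development (not only the maximal ones) fails already at the trivial datum — the time-truncated
Minkowski space `{x⁰ < 1}` is a vacuum Cauchy development of `(ℝ³, δ, 0)` with INCOMPLETE `𝓘⁺` in
the sojourn form (`not_hasCompleteNullInfinity_truncated`, sibling seat 9952). -/
theorem not_forall_development_trivialData :
    ¬ ∀ 𝒟 : VacuumCauchyDevelopment trivialData,
      Summit.FinalStateConjecture.HasCompleteNullInfinity 𝒟.toCauchyDevelopment ∧ Ansatz 𝒟 :=
  fun h ↦ not_hasCompleteNullInfinity_truncated (h truncated).1

/-- (c′) The same for the sixteen-clause property of H′ (landed, general-`Q` form: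
`Negative/LoadBearing.lean` `trivialData_exceptional_forallDev`, `not_isTameGeneric_forallDev_of`). -/
theorem not_forall_development_trivialData' :
    ¬ ∀ 𝒟 : VacuumCauchyDevelopment trivialData,
      Summit.FinalStateConjecture.HasCompleteNullInfinity 𝒟.toCauchyDevelopment ∧ Handoff 𝒟 :=
  fun h ↦ not_hasCompleteNullInfinity_truncated (h truncated).1

/-- (d) WITHIN CLAUSE (1) `Kerr.IsSubextremal (M i) (a i)` CARRIES ONLY `0 < M i`: subextremality is
EQUIVALENT to positivity of the mass together with `r₋ < r₊`, and the latter is already forced by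
`r₋ < rin i < r₊`. (So the mutation "replace `IsSubextremal` by `0 < M`" is an equivalent statement,
and "drop it" only admits non-positive masses, for which `r₊ = M + √(M² − a²) ≤ 0` and the
"exterior" `{r₊ < r}` is everything: the negative-mass naked Kerr–Schild form, gen-1 finding.) -/
theorem isSubextremal_iff_pos_and_rMinus_lt_rPlus (M a : ℝ) :
    Kerr.IsSubextremal M a ↔ 0 < M ∧ Kerr.rMinus M a < Kerr.rPlus M a := by
  refine ⟨fun h ↦ ⟨h.pos, h.rMinus_lt_rPlus⟩, fun ⟨hM, hr⟩ ↦ ?_⟩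
  have hs : 0 < √(M ^ 2 - a ^ 2) := by unfold Kerr.rMinus Kerr.rPlus at hr; linarith
  have h2 : a ^ 2 < M ^ 2 := by
    have := Real.sqrt_pos.1 hs
    linarith
  exact abs_lt_of_sq_lt_sq' h2 hM.le |>.elim (fun h1 h2 ↦ abs_lt.2 ⟨h1, h2⟩)

/-- Clause (1) of the ansatz, equivalent form with the mass sign only. -/
theorem clause_one_iff (M a rin : ℝ) :
    (Kerr.IsSubextremal M a ∧ Kerr.rMinus M a < rin ∧ rin < Kerr.rPlus M a) ↔
      (0 < M ∧ Kerr.rMinus M a < rin ∧ rin < Kerr.rPlus M a) := by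
  rw [isSubextremal_iff_pos_and_rMinus_lt_rPlus]
  constructor
  · rintro ⟨⟨hM, -⟩, h1, h2⟩; exact ⟨hM, h1, h2⟩
  · rintro ⟨hM, h1, h2⟩; exact ⟨⟨hM, h1.trans h2⟩, h1, h2⟩

/-- If the mass is not positive, `r₊ ≤ 0`: the whole slab is "outside the horizon" of such a
(junk) hole, whatever `a` (the square root is `≤ |M| = -M`). -/
theorem rPlus_nonpos_of_nonpos {M : ℝ} (hM : M ≤ 0) (a : ℝ) : Kerr.rPlus M a ≤ 0 := by
  unfold Kerr.rPlus
  have h1 : √(M ^ 2 - a ^ 2) ≤ √(M ^ 2) := Real.sqrt_le_sqrt (by nlinarith [sq_nonneg a])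
  rw [Real.sqrt_sq_eq_abs, abs_of_nonpos hM] at h1
  linarith

end LoadBearing

/-! ## §5 The kinematic shell of the ansatz is consistent for every `N` and `κ` -/

section Kinematics

/-- The unit vector `e₁ ∈ ℝ³`. -/
def e₁ : E3 := EuclideanSpace.single 0 1

@[simp] theorem norm_e₁ : ‖e₁‖ = 1 := by simp [e₁]

/-- EXPLICIT INERTIAL WITNESS for clauses (1)–(5) of `AnsatzN … N` (unit-mass Schwarzschild
parameters, `rin = 1 ∈ (r₋, r₊) = (0, 2)`, trivial Lorentz motions, centres
`ξᵢ(t) = (i/N) κ² t e₁` fanning out inside the cone `κ² t`): the kinematic hypotheses are JOINTLY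
SATISFIABLE for every number of holes and every `0 < κ < 1` — no vacuity comes from clauses (1)–(5);
everything the crux asks of a development sits in the chart/deviation/exterior clauses (6)–(12). -/
theorem kinematics_satisfiable (N : ℕ) {κ : ℝ} (hκ : 0 < κ) (hκ1 : κ < 1) :
    ∃ (M a rin : Fin N → ℝ) (Λ : Fin N → ℝ → lorentzGroup) (ξ : Fin N → ℝ → E3) (γ : ℝ),
      (∀ i, Kerr.IsSubextremal (M i) (a i) ∧ Kerr.rMinus (M i) (a i) < rin i ∧ rin i < Kerr.rPlus (M i) (a i)) ∧
      (∀ i t, |((Λ i t : E4 ≃L[ℝ] E4) (E4.basisVector 0)) 0| ≤ γ) ∧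
      (∀ i, ContDiff ℝ ((⊤ : ℕ∞) : WithTop ℕ∞) (ξ i) ∧
        ContDiff ℝ ((⊤ : ℕ∞) : WithTop ℕ∞) (fun t ↦ ((Λ i t : E4 ≃L[ℝ] E4) : E4 →L[ℝ] E4))) ∧
      (∀ i j, i ≠ j → Tendsto (fun t ↦ ‖ξ i t - ξ j t‖) atTop atTop) ∧
      (0 < κ ∧ κ < 1 ∧ ∀ i, ∀ᶠ t in atTop, ‖ξ i t‖ ≤ κ ^ 2 * t) := by
  refine ⟨fun _ ↦ 1, fun _ ↦ 0, fun _ ↦ 1, fun _ _ ↦ 1, fun i t ↦ ((i : ℝ) / N * κ ^ 2 * t) • e₁, 1,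
    fun i ↦ ⟨?_, ?_, ?_⟩, fun i t ↦ ?_, fun i ↦ ⟨?_, ?_⟩, fun i j hij ↦ ?_, hκ, hκ1, fun i ↦ ?_⟩
  · show |(0 : ℝ)| < 1; simp
  · show Kerr.rMinus 1 0 < 1; simp [Kerr.rMinus]
  · rw [Kerr.rPlus_zero_right zero_le_one]; norm_num
  · show |((1 : E4 ≃L[ℝ] E4) (E4.basisVector 0)) 0| ≤ 1
    rw [show ((1 : E4 ≃L[ℝ] E4) (E4.basisVector 0)) = E4.basisVector 0 from rfl]
    simp
  · exact (contDiff_const.mul contDiff_id).smul contDiff_const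
  · exact contDiff_const
  · have hN : (0 : ℝ) < N := by
      have : 0 < N := Fin.pos i
      exact_mod_cast this
    have hne : ((i : ℝ) - j) / N * κ ^ 2 ≠ 0 := by
      refine mul_ne_zero (div_ne_zero (sub_ne_zero.2 ?_) hN.ne') (pow_ne_zero 2 hκ.ne')
      exact_mod_cast fun h ↦ hij (Fin.ext h)
    have heq : (fun t ↦ ‖((i : ℝ) / N * κ ^ 2 * t) • e₁ - ((j : ℝ) / N * κ ^ 2 * t) • e₁‖) =
        fun t ↦ |((i : ℝ) - j) / N * κ ^ 2| * |t| := by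
      funext t
      rw [← sub_smul, norm_smul, norm_e₁, mul_one, Real.norm_eq_abs, ← abs_mul]
      congr 1; ring
    rw [heq]
    exact (tendsto_abs_atTop_atTop).const_mul_atTop (abs_pos.2 hne)
  · filter_upwards [eventually_ge_atTop 0] with t ht
    rw [norm_smul, norm_e₁, mul_one, Real.norm_eq_abs, abs_of_nonneg (by positivity)]
    have hi : (i : ℝ) / N ≤ 1 := by
      rcases Nat.eq_zero_or_pos N with hN | hN
      · subst hN; exact i.elim0
      · rw [div_le_one (by exact_mod_cast hN)]
        exact_mod_cast i.is_lt.le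
    have : (i : ℝ) / N * κ ^ 2 * t ≤ 1 * κ ^ 2 * t := by gcongr
    linarith

end Kinematics

/-! ## §6 The degenerate instance `N = 0`: the cone weight is identically `1` -/

section NZero

/-- An infimum over `Fin 0` of reals is the junk value `0` (`sInf ∅ = 0` in `ℝ`). -/
theorem iInf_fin_zero (f : Fin 0 → ℝ) : (⨅ i, f i) = 0 := Real.iInf_of_isEmpty f

/-- For `N = 0` the weight `1 + d^{7/4}` of the cone clause is `1` (the distance to the nearest of
NO centres is the junk `0`): the weighted clause degenerates to the unweighted `C³` control on the
cone, consistent with — and implied by — the whole-slab clause. So `N = 0` is a pure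
"asymptotically Minkowskian lab chart" statement (dispersal), no hidden strengthening. -/
theorem weight_fin_zero (f : Fin 0 → ℝ) : ENNReal.ofReal (1 + √(√((⨅ i, f i) ^ 7))) = 1 := by
  rw [iInf_fin_zero]; simp

end NZero

/-! ## §7 BOUNDARY LEMMA: Minkowski space satisfies the conclusion of the crux (ansatz with `N = 0`) -/

section MinkowskiModel

/-- Minkowski spacetime as the vacuum Cauchy development of the trivial data (abbreviation). -/
abbrev 𝒟₀ : VacuumCauchyDevelopment trivialData := Minkowski.vacuumCauchyDevelopment

/-- A point of the Minkowski development read in the global coordinates `E4` (the carrier IS `E4`;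
this reducible cast only fixes the syntactic type for instance search). -/
abbrev toE4 (y : 𝒟₀.carrier) : E4 := y

/-- A point of `E4` as a point of the Minkowski development (inverse reducible cast). -/
abbrev ofE4 (z : E4) : 𝒟₀.carrier := z

/-- The lab chart of the Minkowski model: the identity of `E4` (inclusion of `⊤ : Opens E4`). -/
abbrev Φ₀ : (⊤ : Opens E4) → 𝒟₀.carrier := Subtype.val

/-- The Minkowski reference background on all of `E4`, in the literal form the crux's `let B`
takes for `N = 0` once `∑_{Fin 0} = 0`. -/
abbrev B₀ : ModelBackground := ⟨⊤, fun _ ↦ Minkowski.bilin, fun x ↦ x 0, E4.spatialNorm⟩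

/-- The late half-space `{x⁰ > 0}` as a subset of the Minkowski development. -/
def L₀ : Set 𝒟₀.carrier := Φ₀ '' {x : (⊤ : Opens E4) | (0 : ℝ) < x.1 0}

/-- The self-determined exterior of the Minkowski model: `J⁺({t = 0}) ∩ I⁻({t > 0})`. -/
def O₀ : Set 𝒟₀.carrier := Summit.FinalStateConjecture.exteriorOf 𝒟₀.toCauchyDevelopment L₀

/-- In Minkowski spacetime a point with `0 ≤ y⁰` lies in the causal future of the slice `{t = 0}`. -/
theorem mem_causalFuture_range_embed {y : 𝒟₀.carrier} (hy : 0 ≤ toE4 y 0) :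
    y ∈ 𝒟₀.metric.causalFuture 𝒟₀.timeOrientation (range 𝒟₀.embed) := by
  have hp : ofE4 (E4.ofTimeSpace 0 (E4.spatial (toE4 y))) ∈ range 𝒟₀.embed :=
    ⟨⟨E4.spatial (toE4 y), Minkowski.mem_slice _⟩, rfl⟩
  refine LorentzianMetric.causalFuture_mono (singleton_subset_iff.2 hp) ?_
  have h := Minkowski.causalFuture_singleton (E4.ofTimeSpace 0 (E4.spatial (toE4 y)))
  have h' : toE4 y ∈ LorentzianMetric.causalFuture
      (LorentzianMetric.ofLE (n' := ((⊤ : ℕ∞) : WithTop ℕ∞)) Minkowski.metric le_top)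
      (TimeOrientation.ofLE (n' := ((⊤ : ℕ∞) : WithTop ℕ∞)) Minkowski.timeOrientation le_top)
      {E4.ofTimeSpace 0 (E4.spatial (toE4 y))} := by
    rw [h]
    simp [E4.spatial_ofTimeSpace, hy]
  exact h'

/-- In Minkowski spacetime a point with `y⁰ ≤ t₁` lies in the causal past of any set containing the
slab `{x⁰ = t₁}`. -/
theorem mem_causalPast_of_slab {y : 𝒟₀.carrier} {t₁ : ℝ} (hy : toE4 y 0 ≤ t₁) {T : Set 𝒟₀.carrier}
    (hT : ∀ z : E4, z 0 = t₁ → ofE4 z ∈ T) :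
    y ∈ 𝒟₀.metric.causalPast 𝒟₀.timeOrientation T := by
  have hq : ofE4 (E4.ofTimeSpace t₁ (E4.spatial (toE4 y))) ∈ T := hT _ (by simp)
  refine LorentzianMetric.causalFuture_mono (singleton_subset_iff.2 hq) ?_
  have h := Minkowski.causalPast_singleton (E4.ofTimeSpace t₁ (E4.spatial (toE4 y)))
  have h' : toE4 y ∈ LorentzianMetric.causalPast
      (LorentzianMetric.ofLE (n' := ((⊤ : ℕ∞) : WithTop ℕ∞)) Minkowski.metric le_top)
      (TimeOrientation.ofLE (n' := ((⊤ : ℕ∞) : WithTop ℕ∞)) Minkowski.timeOrientation le_top)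
      {E4.ofTimeSpace t₁ (E4.spatial (toE4 y))} := by
    rw [h]
    simp [E4.spatial_ofTimeSpace, hy]
  exact h'

/-- The late half-space is open (image of an open set under the open embedding `Φ₀`). -/
theorem isOpen_L₀ : IsOpen L₀ := by
  have hopen : IsOpen {x : (⊤ : Opens E4) | (0 : ℝ) < x.1 0} :=
    isOpen_lt continuous_const ((EuclideanSpace.proj (0 : Fin 4)).continuous.comp
      continuous_subtype_val)
  exact (⊤ : Opens E4).2.isOpenEmbedding_subtypeVal.isOpenMap _ hopen

/-- The late half-space lies in its self-determined exterior `O₀ = J⁺({t=0}) ∩ I⁻(L₀)`: in the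
causal future of the slice because `x⁰ > 0`, in `I⁻(L₀)` because an open set lies in its own
chronological past. -/
theorem L₀_subset_O₀ : L₀ ⊆ O₀ := by
  intro y hy
  refine ⟨?_, Summit.FinalStateConjecture.FinalStateConjecture.Theorems.subset_chronologicalPast_of_isOpen
    _ _ isOpen_L₀ hy⟩
  obtain ⟨x, hx, rfl⟩ := hy
  exact mem_causalFuture_range_embed (le_of_lt hx)

/-- The deviation of the identity chart of Minkowski space from `η` vanishes identically
(`dΦ₀ = id`, `mfderiv_subtypeVal`). -/
theorem deviation_B₀ : Minkowski.spacetime.deviation B₀ Φ₀ = 0 := by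
  funext x
  ext v w
  rw [Spacetime.deviation_apply]
  have h := mfderiv_subtypeVal (I' := 𝓡 4) (W := (⊤ : Opens E4)) x
  erw [h]
  show Minkowski.bilin v w - Minkowski.bilin v w = 0
  simp

/-- … hence so does its extension by zero, -/
@[simp] theorem deviationExtend_B₀ : Minkowski.spacetime.deviationExtend B₀ Φ₀ = 0 := by
  funext y
  have h := Spacetime.deviationExtend_coe Minkowski.spacetime B₀ Φ₀ ⟨y, trivial⟩
  exact h.trans (congrFun deviation_B₀ ⟨y, trivial⟩)

/-- … and the `Cᵏ` deviation on every lab slab is `0`. -/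
theorem deviationCk_B₀ (k : ℕ) (t : ℝ) : Minkowski.spacetime.deviationCk B₀ Φ₀ k t = 0 := by
  unfold Spacetime.deviationCk
  rw [deviationExtend_B₀]
  exact supCkENorm_zero _ _

/-- The empty Kerr–Schild sum: for `N = 0` the background bilinear field of the crux is `η`. -/
theorem bilin_add_sum_fin_zero (f : Fin 0 → E4 → E4 →L[ℝ] E4 →L[ℝ] ℝ) :
    (fun x ↦ Minkowski.bilin + ∑ i : Fin 0, f i x) = fun _ ↦ Minkowski.bilin := by
  funext x
  rw [Fin.sum_univ_zero]
  abel

/-- **BOUNDARY LEMMA, core.** Clauses (1)–(12) of the modulated ansatz for the Minkowski development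
with NO hole — `γ = 1`, `κ = 1/2`, `τ₀ = 0`, `U = ⊤`, `Φ = id`, `O = J⁺({t=0}) ∩ I⁻({t>0})` — for any
(empty) families of hole parameters and any background bilinear field `b` equal to `η` (the crux's
`let B` for `N = 0`). -/
theorem ansatz_clauses_minkowski (M a rin : Fin 0 → ℝ) (Λ : Fin 0 → ℝ → lorentzGroup)
    (ξ : Fin 0 → ℝ → E3) (b : E4 → E4 →L[ℝ] E4 →L[ℝ] ℝ) (hb : b = fun _ ↦ Minkowski.bilin) :
    (∀ i, Kerr.IsSubextremal (M i) (a i) ∧ Kerr.rMinus (M i) (a i) < rin i ∧ rin i < Kerr.rPlus (M i) (a i)) ∧ (∀ i t, |((Λ i t : E4 ≃L[ℝ] E4) (E4.basisVector 0)) 0| ≤ (1 : ℝ)) ∧ (∀ i, ContDiff ℝ ((⊤ : ℕ∞) : WithTop ℕ∞) (ξ i) ∧ ContDiff ℝ ((⊤ : ℕ∞) : WithTop ℕ∞) (fun t ↦ ((Λ i t : E4 ≃L[ℝ] E4) : E4 →L[ℝ] E4))) ∧ (∀ i j, i ≠ j → Tendsto (fun t ↦ ‖ξ i t - ξ j t‖)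 atTop atTop) ∧ ((0 : ℝ) < 1 / 2 ∧ (1 / 2 : ℝ) < 1 ∧ ∀ i, ∀ᶠ t in atTop, ‖ξ i t‖ ≤ (1 / 2 : ℝ) ^ 2 * t) ∧ ({x : E4 | (0 : ℝ) < x 0 ∧ ∀ i, rin i < Kerr.radius (a i) (poincareInv (Λ i (x 0)) (E4.ofTimeSpace (x 0) (ξ i (x 0))) x)} ⊆ ((⊤ : Opens E4) : Set E4)) ∧ let B : ModelBackground := ⟨⊤, b, fun x ↦ x 0, E4.spatialNorm⟩; ContMDiff 𝓘(ℝ, E4) (𝓡 4) ((⊤ : ℕ∞) : WithTop ℕ∞) Φ₀ ∧ Topology.IsOpenEmbedding ((B.lateRegion 0).restrict Φ₀) ∧ Φ₀ '' {x : (⊤ : Opens E4) | (0 : ℝ) < x.1 0 ∧ ∀ i, Kerr.rPlus (M i) (a i) < Kerr.radius (a i) (poincareInv (Λ i (x.1 0)) (E4.ofTimeSpace (x.1 0) (ξ i (x.1 0))) x.1)} ⊆ O₀ ∧ Tendsto (fun t ↦ 𝒟₀.toSpacetime.deviationCk B Φ₀ 3 t) atTop (𝓝 0) ∧ Tendsto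 (fun t : ℝ ↦ ⨆ x ∈ {x : (⊤ : Opens E4) | x.1 0 = t ∧ E4.spatialNorm x.1 ≤ 1 / 2 * t}, ⨆ (m : ℕ) (_ : m ≤ 3), ENNReal.ofReal (1 + √(√((⨅ i, ‖E4.spatial x.1 - ξ i t‖) ^ 7))) * ‖iteratedFDeriv ℝ m (𝒟₀.toSpacetime.deviationExtend B Φ₀) x.1‖ₑ) atTop (𝓝 0) ∧ O₀ = Summit.FinalStateConjecture.exteriorOf 𝒟₀.toCauchyDevelopment (Φ₀ '' {x : (⊤ : Opens E4) | (0 : ℝ) < x.1 0 ∧ ∀ i, Kerr.rPlus (M i) (a i) < Kerr.radius (a i) (poincareInv (Λ i (x.1 0)) (E4.ofTimeSpace (x.1 0) (ξ i (x.1 0))) x.1)}) ∧ ∀ t₁ : ℝ, (0 : ℝ) < t₁ → O₀ \ Φ₀ '' {x : (⊤ : Opens E4) | t₁ < x.1 0 ∧ ∀ i, Kerr.rPlus (M i) (a i) < Kerr.radius (a i) (poincareInv (Λ i (x.1 0)) (E4.ofTimeSpace (x.1 0) (ξ i (x.1 0))) x.1)} ⊆ 𝒟₀.metric.causalPast 𝒟₀.timeOrientation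 (Φ₀ '' {x : (⊤ : Opens E4) | x.1 0 = t₁ ∧ ∀ i, Kerr.rPlus (M i) (a i) < Kerr.radius (a i) (poincareInv (Λ i (x.1 0)) (E4.ofTimeSpace (x.1 0) (ξ i (x.1 0))) x.1)}) := by
  subst hb
  refine ⟨fun i ↦ i.elim0, fun i ↦ i.elim0, fun i ↦ i.elim0, fun i ↦ i.elim0,
    ⟨by norm_num, by norm_num, fun i ↦ i.elim0⟩, fun x _ ↦ trivial, ?_⟩
  dsimp only
  refine ⟨?_, ?_, ?_, ?_, ?_, ?_, ?_⟩
  · -- (6) the identity chart is smooth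
    exact contMDiff_subtype_val
  · -- (7) and an open embedding on the late region
    have hopen : IsOpen {x : (⊤ : Opens E4) | (0 : ℝ) < x.1 0} :=
      isOpen_lt continuous_const ((EuclideanSpace.proj (0 : Fin 4)).continuous.comp
        continuous_subtype_val)
    exact (⊤ : Opens E4).2.isOpenEmbedding_subtypeVal.comp hopen.isOpenEmbedding_subtypeVal
  · -- (9) the late half-space lies in `O₀`
    simp only [IsEmpty.forall_iff, and_true]
    exact L₀_subset_O₀
  · -- (10) unweighted deviation: identically `0`
    exact tendsto_const_nhds.congr fun t ↦ (deviationCk_B₀ 3 t).symm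
  · -- (10') weighted deviation inside the cone: identically `0`
    have h0 : (fun t : ℝ ↦ ⨆ x ∈ {x : (⊤ : Opens E4) | x.1 0 = t ∧ E4.spatialNorm x.1 ≤ 1 / 2 * t},
        ⨆ (m : ℕ) (_ : m ≤ 3), ENNReal.ofReal (1 + √(√((⨅ i : Fin 0, ‖E4.spatial x.1 - ξ i t‖) ^ 7))) *
          ‖iteratedFDeriv ℝ m (𝒟₀.toSpacetime.deviationExtend B₀ Φ₀) x.1‖ₑ) = fun _ ↦ 0 := by
      funext t
      simp
    exact (congrArg (fun F : ℝ → ℝ≥0∞ ↦ Tendsto F atTop (𝓝 0)) h0).mpr tendsto_const_nhds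
  · -- (11) `O₀` is the self-determined exterior of the late image
    simp only [IsEmpty.forall_iff, and_true]
    rfl
  · -- (12) exhaustion: `{x⁰ ≤ t₁} ⊆ J⁻({x⁰ = t₁})`
    intro t₁ _ y hy
    have hy' : ¬ t₁ < toE4 y 0 := fun hlt ↦ hy.2 ⟨⟨toE4 y, trivial⟩, ⟨hlt, fun i ↦ i.elim0⟩, rfl⟩
    exact mem_causalPast_of_slab (not_lt.1 hy') fun z hz ↦ ⟨⟨z, trivial⟩, ⟨hz, fun i ↦ i.elim0⟩, rfl⟩

/-- **BOUNDARY LEMMA — Minkowski space satisfies the modulated ansatz with `N = 0`** (the literal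
`∃`-clause of the crux, `AnsatzN … 0`, for `Minkowski.vacuumCauchyDevelopment`). -/
theorem ansatzN_zero_minkowski_exists :
    ∃ (M a rin : Fin 0 → ℝ) (Λ : Fin 0 → ℝ → lorentzGroup) (ξ : Fin 0 → ℝ → E3) (γ κ τ₀ : ℝ) (U : Opens E4) (Φ : U → 𝒟₀.carrier) (O : Set 𝒟₀.carrier), (∀ i, Kerr.IsSubextremal (M i) (a i) ∧ Kerr.rMinus (M i) (a i) < rin i ∧ rin i < Kerr.rPlus (M i) (a i)) ∧ (∀ i t, |((Λ i t : E4 ≃L[ℝ] E4) (E4.basisVector 0)) 0| ≤ γ) ∧ (∀ i, ContDiff ℝ ((⊤ : ℕ∞) : WithTop ℕ∞) (ξ i) ∧ ContDiff ℝ ((⊤ : ℕ∞) : WithTop ℕ∞) (fun t ↦ ((Λ i t : E4 ≃L[ℝ] E4) : E4 →L[ℝ] E4))) ∧ (∀ i j, i ≠ j → Tendsto (fun t ↦ ‖ξ i t - ξ j t‖) atTop atTop) ∧ (0 < κ ∧ κ < 1 ∧ ∀ i, ∀ᶠ t in atTop, ‖ξ i t‖ ≤ κ ^ 2 * t) ∧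 ({x : E4 | τ₀ < x 0 ∧ ∀ i, rin i < Kerr.radius (a i) (poincareInv (Λ i (x 0)) (E4.ofTimeSpace (x 0) (ξ i (x 0))) x)} ⊆ (U : Set E4)) ∧ let B : ModelBackground := ⟨U, fun x ↦ Minkowski.bilin + ∑ i, (boostedKerrBilin (Λ i (x 0)) (E4.ofTimeSpace (x 0) (ξ i (x 0))) (M i) (a i) x - Minkowski.bilin), fun x ↦ x 0, E4.spatialNorm⟩; ContMDiff 𝓘(ℝ, E4) (𝓡 4) ((⊤ : ℕ∞) : WithTop ℕ∞) Φ ∧ Topology.IsOpenEmbedding ((B.lateRegion τ₀).restrict Φ) ∧ Φ '' {x : U | τ₀ < x.1 0 ∧ ∀ i, Kerr.rPlus (M i) (a i) < Kerr.radius (a i) (poincareInv (Λ i (x.1 0)) (E4.ofTimeSpace (x.1 0) (ξ i (x.1 0))) x.1)} ⊆ O ∧ Tendsto (fun t ↦ 𝒟₀.toSpacetime.deviationCk B Φ 3 t) atTop (𝓝 0) ∧ Tendsto (fun t : ℝ ↦ ⨆ x ∈ {x : U | x.1 0 = t ∧ E4.spatialNorm x.1 ≤ κ * t}, ⨆ (m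 : ℕ) (_ : m ≤ 3), ENNReal.ofReal (1 + √(√((⨅ i, ‖E4.spatial x.1 - ξ i t‖) ^ 7))) * ‖iteratedFDeriv ℝ m (𝒟₀.toSpacetime.deviationExtend B Φ) x.1‖ₑ) atTop (𝓝 0) ∧ O = Summit.FinalStateConjecture.exteriorOf 𝒟₀.toCauchyDevelopment (Φ '' {x : U | τ₀ < x.1 0 ∧ ∀ i, Kerr.rPlus (M i) (a i) < Kerr.radius (a i) (poincareInv (Λ i (x.1 0)) (E4.ofTimeSpace (x.1 0) (ξ i (x.1 0))) x.1)}) ∧ ∀ t₁ : ℝ, τ₀ < t₁ → O \ Φ '' {x : U | t₁ < x.1 0 ∧ ∀ i, Kerr.rPlus (M i) (a i) < Kerr.radius (a i) (poincareInv (Λ i (x.1 0)) (E4.ofTimeSpace (x.1 0) (ξ i (x.1 0))) x.1)} ⊆ 𝒟₀.metric.causalPast 𝒟₀.timeOrientation (Φ '' {x : U | x.1 0 = t₁ ∧ ∀ i, Kerr.rPlus (M i) (a i) < Kerr.radius (a i) (poincareInv (Λ i (x.1 0)) (E4.ofTimeSpace (x.1 0) (ξ i (x.1 0))) x.1)}) 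:=
  ⟨Fin.elim0, Fin.elim0, Fin.elim0, Fin.elim0, Fin.elim0, 1, 1 / 2, 0, ⊤, Φ₀, O₀,
    ansatz_clauses_minkowski _ _ _ _ _ _ (bilin_add_sum_fin_zero _)⟩

/-- The ansatz clause of the crux holds for the Minkowski development (with `N = 0`). -/
theorem ansatz_minkowski : Ansatz 𝒟₀ := ⟨0, ansatzN_zero_minkowski_exists⟩

/-- **The per-development CONCLUSION of the crux — complete `𝓘⁺` (sojourn form) AND modulated
multi-Kerr–Schild asymptotics — holds for a genuine vacuum Cauchy development of an admissible
datum**: Minkowski space over `(ℝ³, δ, 0)` (`minkowski_hasCompleteNullInfinity`, sibling seat 9952,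
plus `ansatz_minkowski`). ANTI-VACUITY / ANTI-CONTRADICTION CERTIFICATE: the twelve clauses of the
ansatz are jointly satisfiable together with censorship, so no refutation can come from an internal
inconsistency of the conclusion (which, the admissible class of `ℝ³` being nonempty, would have
killed the crux outright by `not_modulatedKerrHandoff_of_forall_not`). -/
theorem conclusion_minkowski :
    Summit.FinalStateConjecture.HasCompleteNullInfinity 𝒟₀.toCauchyDevelopment ∧ Ansatz 𝒟₀ :=
  ⟨minkowski_hasCompleteNullInfinity, ansatz_minkowski⟩

/-- NEAR-MISS MADE PRECISE (no `sorry`; rev-5 property, see §12 for rev 6): the trivial datum HAS the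
twelve-clause property — hence the pointwise route "every admissible datum on `ℝ³` is exceptional" to a
kill of H(rev 5) is CLOSED — modulo exactly
two standard facts absent from the tree: (i) MAXIMALITY of the Minkowski development among vacuum
Cauchy developments of `(ℝ³, δ, 0)` (Choquet-Bruhat–Geroch; PDE uniqueness), and (ii) invariance of
the conclusion under isometry of developments (geodesic/causal naturality; compare
`CompleteNullInfinityInvariant` of seat 9952). MGHD uniqueness up to isometry IS a theorem of the
tree (`mghd_unique_cauchy`), which is why (i)+(ii) suffice. -/
theorem trivialData_ansatzProp_of (hmax : 𝒟₀.IsMaximal)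
    (hinv : ∀ 𝒟 : VacuumCauchyDevelopment trivialData, 𝒟₀.IsIsometricTo 𝒟.toCauchyDevelopment →
      (Summit.FinalStateConjecture.HasCompleteNullInfinity 𝒟₀.toCauchyDevelopment ∧ Ansatz 𝒟₀) →
        (Summit.FinalStateConjecture.HasCompleteNullInfinity 𝒟.toCauchyDevelopment ∧ Ansatz 𝒟)) :
    AnsatzProp Minkowski.slice trivialData :=
  ⟨⟨𝒟₀, hmax⟩, fun 𝒟 h𝒟 ↦ hinv 𝒟 (mghd_unique_cauchy 𝒟₀ 𝒟 hmax h𝒟) conclusion_minkowski⟩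

end MinkowskiModel

/-! ## §8 Hidden exactness in the exterior / exhaustion clauses (9), (11), (12) -/

section Exactness

variable {X : Type} [TopologicalSpace X] [ChartedSpace E3 X] [IsManifold (𝓡 3) ((⊤ : ℕ∞) : WithTop ℕ∞) X]
  [ConnectedSpace X] {D : InitialDataSet (𝓡 3) X}

/-- **The whole late exterior chart image lies to the causal future of the Cauchy surface.**
Clauses (9) `Φ(Ext_{>τ₀}) ⊆ O` and (11) `O = J⁺(ι Σ) ∩ I⁻(Φ(Ext_{>τ₀}))` force
`Φ(Ext_{>τ₀}) ⊆ J⁺(ι Σ)` — for ALL lab times `> τ₀` and ALL the way out to spatial infinity. This is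
an exact, global requirement on the lab frame: its late slabs may nowhere dip below `ι(Σ)` near `i⁰`.
In Minkowski space a BOOSTED lab frame violates it (`exists_boostedLate_not_mem_causalFuture`); a
prover of H must adapt the lab frame to the data's asymptotic rest frame and, for slowly decaying
tails (ι(Σ) ~ {t = w(x)}, w = o(|x|)), bend the slabs up near infinity at a rate → 0 (costing only
`o(1)` in the `C³` deviation). For provers of `InertialRecession` this inclusion is a free
hypothesis. -/
theorem late_image_subset_causalFuture {𝒟 : VacuumCauchyDevelopment D} {L O : Set 𝒟.carrier}
    (hLO : L ⊆ O) (hO : O = Summit.FinalStateConjecture.exteriorOf 𝒟.toCauchyDevelopment L) :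
    L ⊆ 𝒟.metric.causalFuture 𝒟.timeOrientation (range 𝒟.embed) :=
  fun _ hp ↦ (hO ▸ hLO hp).1

/-- The same, read off the ansatz: under `AnsatzN 𝒟 N` there are parameters and a lab chart whose
late exterior image lies in `J⁺(ι Σ)`. -/
theorem exists_late_subset_causalFuture_of_ansatzN {𝒟 : VacuumCauchyDevelopment D} {N : ℕ}
    (h : AnsatzN 𝒟 N) :
    ∃ (M a : Fin N → ℝ) (Λ : Fin N → ℝ → lorentzGroup) (ξ : Fin N → ℝ → E3) (τ₀ : ℝ) (U : Opens E4)
      (Φ : U → 𝒟.carrier),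
      Φ '' {x : U | τ₀ < x.1 0 ∧ ∀ i, Kerr.rPlus (M i) (a i) < Kerr.radius (a i)
        (poincareInv (Λ i (x.1 0)) (E4.ofTimeSpace (x.1 0) (ξ i (x.1 0))) x.1)} ⊆
        𝒟.metric.causalFuture 𝒟.timeOrientation (range 𝒟.embed) := by
  obtain ⟨M, a, rin, Λ, ξ, γ, κ, τ₀, U, Φ, O, h1, h2, h3, h4, h5, hU, hB⟩ := h
  obtain ⟨hΦ, hemb, himO, hdev, hwt, hO, hexh⟩ := hB
  exact ⟨M, a, Λ, ξ, τ₀, U, Φ, late_image_subset_causalFuture himO hO⟩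

/-- **Exhaustion read contrapositively.** Clause (12): for `t₁ > τ₀`, a point outside the late
exterior image `L t₁ = Φ(Ext_{>t₁})` and outside `J⁻(S t₁)`, `S t₁ = Φ(Slab_{t₁} ∩ Ext)`, is NOT in
`O`. Physical content (docstring only — the causal facts are about the true metric): `x⁰` is a time
function on the charted region at late times (Kerr–Schild slabs have `g^{00} ≤ −1`, stable under
`C⁰`-small deviations) and the core boundaries `{rᵢ = rin}` (`r₋ < rin < r₊`) are spacelike,
future = inward; so a charted point at lab time `> t₁` with `rᵢ ≤ r₊` for some `i` (on or inside an
ANSATZ horizon) can lie in `J⁻(S t₁)` only by leaving the chart through a core, after which it cannot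
return. Hence such points are NOT in `O = J⁺(ιΣ) ∩ I⁻(Φ(Ext))`, i.e. no timelike curve leads from
them back to `{all rⱼ > r₊}`: the moving coordinate balls `{rᵢ ≤ r₊(Mᵢ,aᵢ)}` must be FUTURE SETS
(weakly inside the true black-hole region) at EVERY lab time `> τ₀` — an exact horizon
normalisation (`g⁻¹(drᵢ, drᵢ) ≤ 0` on `{rᵢ = r₊}`), not an asymptotic one. It is achievable by a
radial gauge adjustment of size `δ(t) ≫ sup|h|(t)`, `δ → 0` (bounded cone weight near the holes),
so it does not bite H; for `InertialRecession` it is again a usable hypothesis. -/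
theorem not_mem_exterior_of_not_mem_causalPast {𝒟 : VacuumCauchyDevelopment D} {O : Set 𝒟.carrier}
    {τ₀ : ℝ} {L S : ℝ → Set 𝒟.carrier}
    (hexh : ∀ t₁ : ℝ, τ₀ < t₁ → O \ L t₁ ⊆ 𝒟.metric.causalPast 𝒟.timeOrientation (S t₁))
    {t₁ : ℝ} (ht₁ : τ₀ < t₁) {p : 𝒟.carrier} (hpL : p ∉ L t₁)
    (hpS : p ∉ 𝒟.metric.causalPast 𝒟.timeOrientation (S t₁)) : p ∉ O :=
  fun hpO ↦ hpS (hexh t₁ ht₁ ⟨hpO, hpL⟩)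

/-- Consequently the uncharted-late part of `O` lies below EVERY late exterior slab:
`O ∖ ⋃_{t₁>τ₀} L t₁ ⊆ ⋂_{t₁>τ₀} J⁻(S t₁)` when the `L t₁` decrease — "the chart covers the whole
late exterior". -/
theorem diff_iUnion_subset_iInter_causalPast {𝒟 : VacuumCauchyDevelopment D} {O : Set 𝒟.carrier}
    {τ₀ : ℝ} {L S : ℝ → Set 𝒟.carrier}
    (hexh : ∀ t₁ : ℝ, τ₀ < t₁ → O \ L t₁ ⊆ 𝒟.metric.causalPast 𝒟.timeOrientation (S t₁)) :
    O \ (⋃ t₁ ∈ Ioi τ₀, L t₁) ⊆ ⋂ t₁ ∈ Ioi τ₀, 𝒟.metric.causalPast 𝒟.timeOrientation (S t₁) := by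
  intro p hp
  simp only [mem_iInter, mem_Ioi]
  intro t₁ ht₁
  refine hexh t₁ ht₁ ⟨hp.1, fun hpL ↦ hp.2 ?_⟩
  exact mem_iUnion₂.2 ⟨t₁, ht₁, hpL⟩

/-- In Minkowski space the causal future of the slice `{t = 0}` is contained in `{t ≥ 0}`. -/
theorem causalFuture_range_embed_subset {y : 𝒟₀.carrier}
    (hy : y ∈ 𝒟₀.metric.causalFuture 𝒟₀.timeOrientation (range 𝒟₀.embed)) : 0 ≤ toE4 y 0 := by
  rw [LorentzianMetric.causalFuture_eq_biUnion] at hy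
  obtain ⟨p, hp, hyp⟩ := mem_iUnion₂.1 hy
  obtain ⟨z, rfl⟩ := hp
  have h := Minkowski.causalFuture_singleton (E4.ofTimeSpace 0 (z : E3))
  have h' : toE4 y ∈ LorentzianMetric.causalFuture
      (LorentzianMetric.ofLE (n' := ((⊤ : ℕ∞) : WithTop ℕ∞)) Minkowski.metric le_top)
      (TimeOrientation.ofLE (n' := ((⊤ : ℕ∞) : WithTop ℕ∞)) Minkowski.timeOrientation le_top)
      {E4.ofTimeSpace 0 (z : E3)} := hyp
  rw [h] at h'
  have h'' : ‖E4.spatial (toE4 y) - E4.spatial (E4.ofTimeSpace 0 (z : E3))‖ ≤ toE4 y 0 - 0 := by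
    simpa using h'
  linarith [norm_nonneg (E4.spatial (toE4 y) - E4.spatial (E4.ofTimeSpace 0 (z : E3)))]

/-- **A boosted lab frame violates clause (9)+(11) in Minkowski space**: the event
`y = (−1, −3, 0, 0)` has POSITIVE boosted time `t' = γ(t − v x¹)` for `v = 1/2` (so it lies in the
late half-space `{t' > 0}` of the boosted frame) but is NOT in `J⁺({t = 0})`. So the `N = 0` ansatz
for Minkowski cannot be witnessed in a boosted frame — only in frames asymptotically at rest w.r.t.
the Cauchy slice (cf. §7, which uses the rest frame). -/
theorem exists_boostedLate_not_mem_causalFuture :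
    ∃ y : E4, 0 < y 0 - (1 / 2 : ℝ) * y 1 ∧
      ofE4 y ∉ 𝒟₀.metric.causalFuture 𝒟₀.timeOrientation (range 𝒟₀.embed) := by
  refine ⟨E4.ofTimeSpace (-1) ((-3 : ℝ) • EuclideanSpace.single 0 1), ?_, fun h ↦ ?_⟩
  · have h1 : E4.ofTimeSpace (-1) ((-3 : ℝ) • EuclideanSpace.single 0 1) 1 = -3 := by
      rw [show (1 : Fin 4) = (0 : Fin 3).succ from rfl, E4.ofTimeSpace_apply_succ]
      simp
    rw [h1, E4.ofTimeSpace_apply_zero]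
    norm_num
  · have := causalFuture_range_embed_subset h
    norm_num at this

end Exactness

/-! ## §9 Threat ledger / open regimes (why the crux resists) -/

/-- THREAT LEDGER PER CLAUSE (gen 2 items 1–10 kept; gen 3 / H′ items 11–13 NEW; informal, with the
nearest printed results), recording why no clause yields a Lean-level or paper-level refutation of the
TAME CODIMENSION-ONE-GENERIC statement H′.

1. `m = 0` cone weight `(1 + d^{7/4})|h| → 0` out to `d ~ κt` VERSUS admissible tails. A linear
   tail `h ~ r^{-1-ε}` of the data (allowed by `o₂(r⁻¹)`) produces, in every gauge, an interior
   deviation `≳ t^{-1-ε}` at `|x| = κt`; so for `ε < 3/4` the weighted clause fails — for EVERY MGHD of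
   such a datum. Under H′ the exceptional set so obtained is STILL swallowable, but only by COMPOSITE
   witnesses: tail trimming at radius `R(c) → ∞` (Corvino–Schoen / Chruściel–Delay gluing to exact Kerr
   ends) IS tame (`wDist` of the trimmed member to `d` is `≲ sup_{r>R(c)} r·|o(r⁻¹)| + 2|M(c)−M₀| → 0`,
   BN-T2 of `TameWitnessConstraints.md`) but NOT immersed (`not_isImmersedAtZero_of_eventuallyEq`, §11),
   so it must be composed with a compactly supported first-order direction (breathing / conformal
   kick: `TameBreathingCurve.lean`); the members are good iff trimmed data with a local kick are
   generically good — a `FarFieldInsensitivity` (receding-basin) statement, BN-T1. Refs: Price-law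
   tails arXiv:2102.11884, arXiv:2202.04093; Bieri's class arXiv:0904.0620; gluing arXiv:gr-qc/0301071.
2. SUB-EXTREMALITY of the final holes (`|aᵢ| < Mᵢ`, clause (1)). Third-law violations: Kehle–Unger
   form EXACTLY extremal horizons in finite time (arXiv:2211.15742; arXiv:2402.10190); the vacuum-Kerr
   analogue is conjectural, and extremal formation is a CODIMENSION-ONE phenomenon — exactly what
   `IsTameChristodoulouGeneric … 1` tolerates (the unfolding families of a critical hypersurface are
   compactly supported deformations, hence tame).
3. COMPLETE `𝓘⁺`. Vacuum naked singularities exist (arXiv:1912.08478, arXiv:2204.09891) from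
   non-generic, rough self-similar data; no positive-codimension-violating family is known (that would
   kill tame weak cosmic censorship and the summit with it: `isTameGeneric_wcc_of_handoff`).
4. FINITE `N`, NO OTHER ATTRACTORS: no mechanism in print (soliton resolution is the conjecture).
5. HORIZON-PENETRATING `C³` CONVERGENCE down to `rin ∈ (r₋, r₊)` for ALL `|a| < M`: nonlinear Kerr
   stability in print for `|a| ≪ M` (arXiv:2104.11857, arXiv:2205.14808), claimed for the full range
   (Hintz 2026, tree fact `hintz_kerr_stability_subextremal_cauchy`, under review); open, not refutable.
6. WHOLE-SLAB UNWEIGHTED `C³` SUP `→ 0`: consistent with `M > 0`; needs the lab frame adapted to `ι(Σ)`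
   (§8). Rough THIRD derivatives at infinity (`A r⁻¹² sin(r⁵)`-type tails, TRIAGE-r1-1 R2) are a dense
   `k = 3` stratum of exceptional data, swallowable like item 1 (trimming ⊕ kick).
7. JUNK `Σ`: non-Hausdorff excluded by `[T2Space]` (§4(b)); empty `Σ` by `[ConnectedSpace]`; topology
   hides behind horizons.
8. `lorentzGroup = O(1,3)` contains time reversal: NOW EXCLUDED by (O) (orthochronous painted frames);
   (O) is rigid in `t` (§13) and with (2) reads `1 ≤ (Λᵢ(t)e₀)⁰ ≤ γ`.
9. The exactness constraints of §8 are met by gauge choices costing `o(1)` in `C³`.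
10. WHAT WOULD KILL H(rev 5) IN LEAN: a property of the datum ON A COMPACT SET, continuous along
    `IsSmoothDataFamily` curves at `0` and forcing `¬HandoffProp` — one clause away (§4(a)).
11. (NEW) TAMENESS. Burial (`M(c) → ∞`) is not tame (`burial_not_tame`, from the sibling lane's
    `not_isTameDataFamily_of_mass_tendsto_atTop`); receding-only modifications are not immersed (§11);
    fixed-energy receding pulses are not tame (`wDist ≍ R³A/w²`, BN-T2). What tameness ADDS for a
    refuter: the ADM mass (and the `r⁻²` moment of `k`) is CONTINUOUS along tame curves at `c = 0`
    (`tendsto_mass_of_isTameDataFamily`), so an exceptional set containing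
    `{d' admissible : |M(d') − M(d)| < ε} ∩ (a C^∞_loc-neighbourhood of d on a compact set)` would be a
    TAME TRAP. No clause of `HandoffProp` is decided by the mass and local jets (scaling; domain of
    dependence), so no trap results — but this is the complete list of trap-building functionals now.
12. (NEW) THE HANDOFF CLAUSES. Consistency: all sixteen clauses hold at `N = 0` in Minkowski (§7, §12)
    and, on paper + the swallow-transfer machinery, at `N = 1` for static Kerr-shielded data (`t*` is a
    time function on `{r > 0}`, `∂₀G ≡ 0`, interior rays affinely bounded). (T): for the true metric
    `x⁰` is a time function on late charted slabs (`g^{00} ≤ −c < 0` for Kerr–Schild slabs, stable under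
    `C¹`-small deviation) and the core boundaries `{rᵢ = rin}` are spacelike with future = inward, so a
    causal curve leaving through a core never returns: (T) is bookkeeping for a prover, exact for E′.
    (R): with (9)+(11), `closure O ⊇` every future-complete ray from `Σ` — rays entering a sub-extremal
    hole reach `r = rin` at finite affine parameter (not complete), trapped rays at the photon sphere
    stay in the charted exterior: no lever. (QS): a GENUINE extra demand on the painted boosts — for one
    Schwarzschild hole it is EQUIVALENT to the rate `t^{3/4}‖(Λe₀)˙‖ → 0`
    (`…StubWeightedRatesNecessityQS.weightedRate_e0_of_QS_one` /
    `…StubWeightedRatesReductionE0.stub_quasiStationarity_of_weightedRates_e0`), NOT implied by clauses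
    (1)–(5) even with third-order slaving (`WeightedQuasiStationarity/Negative/KinematicShadow.lean`:
    `w(t) = ¼(1+t²)^{-1/4} sin t`), but satisfied by inertial and by EIH-accelerated motions (margins
    `t^{-1/4}` hyperbolic, `t^{-7/12}` parabolic); a prover may always re-paint with smoothed moduli.
    (10′) `m = 0` weight vs PARABOLIC final separations `D ~ t^{2/3}`: the instantaneous-position
    superposition misses retardation/cross terms of weighted size `t^{5/12}`, `t^{1/12}` after CM
    cancellation (rattack ATTACK.md §7) — such developments are exceptional; parabolic final motions are
    non-generic (Chazy–Marchal–Saari), so tame genericity absorbs them, but E′'s parabolic bookkeeping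
    concerns configurations H′ itself excludes (planner note, not a kill).
13. (NEW) WHAT WOULD KILL H′ IN LEAN: (α) a kill of tame typed WCC (17269) — same obstruction (MGHD in
    hand); (β) `∀ D ∈ admissibleVacuumData ℝ³, ¬HandoffProp D` — closed at the model point modulo
    Minkowski maximality (§7, §12); (γ) a TAME TRAP (item 11) — needs a clause decided by mass + jets,
    none is; (δ) an internal inconsistency of the sixteen clauses for every `N` — refuted by §12. -/
theorem regimes_note : True := trivial

/-! ## §10 THE ANSATZ IS INVARIANT UNDER ISOMETRY OF DEVELOPMENTS (new brick; the `∀ MGHD` bundling is harmless for the ansatz) -/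

section Transport

variable {E : Type*} [NormedAddCommGroup E] [NormedSpace ℝ E] {H : Type*} [TopologicalSpace H]
  {I : ModelWithCorners ℝ E H} {n : ℕ∞ω} {M : Type*} [TopologicalSpace M] [ChartedSpace H M]
  [IsManifold I ∞ M]
  {E' : Type*} [NormedAddCommGroup E'] [NormedSpace ℝ E'] {H' : Type*} [TopologicalSpace H']
  {I' : ModelWithCorners ℝ E' H'} {N : Type*} [TopologicalSpace N] [ChartedSpace H' N]
  [IsManifold I' ∞ N]
  {g : LorentzianMetric I n M} {τ : TimeOrientation g}
  {gN : LorentzianMetric I' n N} {τN : TimeOrientation gN}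

/-- Time-orientation preserving isometric immersions carry future TIMELIKE curves to future
timelike curves (the timelike companion of `IsFutureCausalCurveOn.comp_mdifferentiable`). -/
theorem isFutureTimelikeCurveOn_comp {φ : N → M} (hφd : MDifferentiable I' I φ)
    (hτ : τN.PreservesTimeOrientation φ τ)
    (hφ : ∀ y, pullbackBilin (I := I) (I' := I') φ g.val y = gN.val y) {γ : ℝ → N} {s : Set ℝ}
    (hγ : gN.IsFutureTimelikeCurveOn τN γ s) : g.IsFutureTimelikeCurveOn τ (φ ∘ γ) s := by
  intro t ht
  obtain ⟨hd, htl, hfd⟩ := hγ t ht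
  have hvel : velocity I (φ ∘ γ) t = mfderiv I' I φ (γ t) (velocity I' γ t) := by
    unfold velocity
    rw [mfderiv_comp t (hφd (γ t)) hd]
    rfl
  refine ⟨(hφd (γ t)).comp t hd, ?_, ?_⟩
  · rw [hvel, LorentzianMetric.isTimelike_iff]
    have key := congrArg (fun b ↦ b (velocity I' γ t) (velocity I' γ t)) (hφ (γ t))
    simp only [pullbackBilin_apply] at key
    change g.val (φ (γ t)) (mfderiv I' I φ (γ t) (velocity I' γ t))
      (mfderiv I' I φ (γ t) (velocity I' γ t)) < 0
    rw [key]
    exact htl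
  · rw [hvel]
    exact hτ.isFutureDirected_mfderiv hφ hfd

/-- `φ(I⁺(S)) ⊆ I⁺(φ(S))` for a time-orientation preserving isometric immersion `φ`. -/
theorem image_chronologicalFuture_subset {φ : N → M} (hφd : MDifferentiable I' I φ)
    (hτ : τN.PreservesTimeOrientation φ τ)
    (hφ : ∀ y, pullbackBilin (I := I) (I' := I') φ g.val y = gN.val y) (S : Set N) :
    φ '' gN.chronologicalFuture τN S ⊆ g.chronologicalFuture τ (φ '' S) := by
  rintro _ ⟨q, ⟨p, hp, γ, a, b, hab, hγ, hγa, hγb⟩, rfl⟩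
  refine ⟨φ p, mem_image_of_mem φ hp, φ ∘ γ, a, b, hab, isFutureTimelikeCurveOn_comp hφd hτ hφ hγ,
    ?_, ?_⟩
  · simp [hγa]
  · simp [hγb]

/-- `φ(I⁻(S)) ⊆ I⁻(φ(S))` for a time-orientation preserving isometric immersion `φ`. -/
theorem image_chronologicalPast_subset {φ : N → M} (hφd : MDifferentiable I' I φ)
    (hτ : τN.PreservesTimeOrientation φ τ)
    (hφ : ∀ y, pullbackBilin (I := I) (I' := I') φ g.val y = gN.val y) (S : Set N) :
    φ '' gN.chronologicalPast τN S ⊆ g.chronologicalPast τ (φ '' S) :=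
  image_chronologicalFuture_subset hφd hτ.reverse hφ S

end Transport

section Invariance

variable {X : Type} [TopologicalSpace X] [ChartedSpace E3 X] [IsManifold (𝓡 3) ((⊤ : ℕ∞) : WithTop ℕ∞) X]
  [ConnectedSpace X] {D : InitialDataSet (𝓡 3) X}

/-- **THE MODULATED ANSATZ IS INVARIANT UNDER ISOMETRY OF DEVELOPMENTS.** If `ψ : M₁ ≃ M₂` is a
time-orientation preserving isometry with `ψ ∘ ι₁ = ι₂` and `𝒟₁` carries the ansatz with `N` holes
(parameters, lab chart `Φ`, exterior `O`), then `𝒟₂` carries it with the SAME parameters, the lab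
chart `ψ ∘ Φ` and the exterior `ψ(O)`: the deviation is unchanged (`Spacetime.deviation_comp`),
and `ψ` transports `J^±`, `I^±`, the Cauchy surface and set differences. -/
theorem ansatzN_of_isIsometricTo {𝒟₁ 𝒟₂ : VacuumCauchyDevelopment D}
    (h : 𝒟₁.IsIsometricTo 𝒟₂.toCauchyDevelopment) {N : ℕ} (hA : AnsatzN 𝒟₁ N) : AnsatzN 𝒟₂ N := by
  obtain ⟨ψ, hiso, hτ, hι⟩ := h
  -- standard facts about `ψ` and `ψ⁻¹`
  have hψd : MDifferentiable (𝓡 4) (𝓡 4) ψ := ψ.contMDiff.mdifferentiable (by simp)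
  have hψsd : MDifferentiable (𝓡 4) (𝓡 4) ψ.symm := ψ.symm.contMDiff.mdifferentiable (by simp)
  have hid : (ψ : 𝒟₁.carrier → 𝒟₂.carrier) ∘ ψ.symm = id := funext ψ.apply_symm_apply
  have hψ : ∀ y, pullbackBilin (I := 𝓡 4) (I' := 𝓡 4) ψ 𝒟₂.metric.val y = 𝒟₁.metric.val y := hiso
  have hiso' : ∀ z, pullbackBilin (I := 𝓡 4) (I' := 𝓡 4) ψ.symm 𝒟₁.metric.val z = 𝒟₂.metric.val z := by
    intro z
    have h1 : 𝒟₁.metric.val = pullbackBilin (I := 𝓡 4) (I' := 𝓡 4) ψ 𝒟₂.metric.val :=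
      (funext hiso).symm
    rw [h1, ← pullbackBilin_comp hψd hψsd, hid, pullbackBilin_id]
  have hkey : ∀ (z : 𝒟₂.carrier) (w : TangentSpace (𝓡 4) z),
      mfderiv (𝓡 4) (𝓡 4) ψ (ψ.symm z) (mfderiv (𝓡 4) (𝓡 4) ψ.symm z w) = w := by
    intro z w
    have h := mfderiv_comp z (hψd (ψ.symm z)) (hψsd z)
    rw [hid, mfderiv_id] at h
    exact (congrArg (fun L ↦ L w) h).symm
  have hτ' : 𝒟₂.timeOrientation.PreservesTimeOrientation ψ.symm 𝒟₁.timeOrientation := by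
    intro z
    refine hτ.isFutureDirected_of_mfderiv hiso ?_
    rw [hkey, ψ.apply_symm_apply]
    exact 𝒟₂.timeOrientation.isFutureDirected_vectorField z
  have hinj : Injective (ψ : 𝒟₁.carrier → 𝒟₂.carrier) := ψ.injective
  have hsymm_image : ∀ S : Set 𝒟₁.carrier, ψ.symm '' (ψ '' S) = S := fun S ↦ by
    rw [image_image]; simp
  -- transport of causal/chronological futures and pasts as EQUALITIES
  have hJp : ∀ S : Set 𝒟₁.carrier, ψ '' 𝒟₁.metric.causalFuture 𝒟₁.timeOrientation S =
      𝒟₂.metric.causalFuture 𝒟₂.timeOrientation (ψ '' S) := fun S ↦ by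
    refine Subset.antisymm (LorentzianMetric.image_causalFuture_subset hψd hτ hψ S) fun q hq ↦ ?_
    have h1 := LorentzianMetric.image_causalFuture_subset hψsd hτ' hiso' (ψ '' S)
      (mem_image_of_mem ψ.symm hq)
    rw [hsymm_image] at h1
    exact ⟨ψ.symm q, h1, ψ.apply_symm_apply q⟩
  have hJm : ∀ S : Set 𝒟₁.carrier, ψ '' 𝒟₁.metric.causalPast 𝒟₁.timeOrientation S =
      𝒟₂.metric.causalPast 𝒟₂.timeOrientation (ψ '' S) := fun S ↦ by
    refine Subset.antisymm (LorentzianMetric.image_causalPast_subset hψd hτ hψ S) fun q hq ↦ ?_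
    have h1 := LorentzianMetric.image_causalPast_subset hψsd hτ' hiso' (ψ '' S)
      (mem_image_of_mem ψ.symm hq)
    rw [hsymm_image] at h1
    exact ⟨ψ.symm q, h1, ψ.apply_symm_apply q⟩
  have hIm : ∀ S : Set 𝒟₁.carrier, ψ '' 𝒟₁.metric.chronologicalPast 𝒟₁.timeOrientation S =
      𝒟₂.metric.chronologicalPast 𝒟₂.timeOrientation (ψ '' S) := fun S ↦ by
    refine Subset.antisymm (image_chronologicalPast_subset hψd hτ hψ S) fun q hq ↦ ?_
    have h1 := image_chronologicalPast_subset hψsd hτ' hiso' (ψ '' S) (mem_image_of_mem ψ.symm hq)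
    rw [hsymm_image] at h1
    exact ⟨ψ.symm q, h1, ψ.apply_symm_apply q⟩
  have hrange : range 𝒟₂.embed = ψ '' range 𝒟₁.embed := by
    rw [← hι, Set.range_comp]
  -- unpack the ansatz of `𝒟₁`
  obtain ⟨Mh, a, rin, Λ, ξ, γ, κ, τ₀, U, Φ, O, h1, h2, h3, h4, h5, hU, hB⟩ := hA
  obtain ⟨hΦ, hemb, himO, hdev, hwt, hO, hexh⟩ := hB
  have hΦd : MDifferentiable 𝓘(ℝ, E4) (𝓡 4) Φ := hΦ.mdifferentiable (by simp)
  refine ⟨Mh, a, rin, Λ, ξ, γ, κ, τ₀, U, ψ ∘ Φ, ψ '' O, h1, h2, h3, h4, h5, hU, ?_⟩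
  -- the deviation is unchanged (for every background on the chart domain `U`)
  have hdevEq : ∀ (b : E4 → E4 →L[ℝ] E4 →L[ℝ] ℝ) (tf rf : E4 → ℝ),
      𝒟₂.toSpacetime.deviationExtend ⟨U, b, tf, rf⟩ (ψ ∘ Φ) =
        𝒟₁.toSpacetime.deviationExtend ⟨U, b, tf, rf⟩ Φ := by
    intro b tf rf
    unfold Spacetime.deviationExtend
    rw [Spacetime.deviation_comp ⟨U, b, tf, rf⟩ hψd hψ hΦd]
  have hCkEq : ∀ (b : E4 → E4 →L[ℝ] E4 →L[ℝ] ℝ) (tf rf : E4 → ℝ) (k : ℕ) (t : ℝ),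
      𝒟₂.toSpacetime.deviationCk ⟨U, b, tf, rf⟩ (ψ ∘ Φ) k t =
        𝒟₁.toSpacetime.deviationCk ⟨U, b, tf, rf⟩ Φ k t := by
    intro b tf rf k t
    unfold Spacetime.deviationCk
    rw [hdevEq b tf rf]
  refine ⟨ψ.contMDiff.comp hΦ, ψ.toHomeomorph.isOpenEmbedding.comp hemb, ?_, ?_, ?_, ?_, ?_⟩
  · -- (9) late exterior image inside `ψ(O)`
    rw [image_comp]
    exact image_mono himO
  · -- (10) unweighted deviation
    simpa only [hCkEq] using hdev
  · -- (10') weighted deviation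
    simpa only [hdevEq] using hwt
  · -- (11) the self-determined exterior is transported
    rw [hO, image_comp]
    unfold Summit.FinalStateConjecture.exteriorOf
    rw [image_inter hinj, hJp, hIm, hrange]
  · -- (12) exhaustion is transported
    intro t₁ ht₁
    rw [image_comp, image_comp, ← image_sdiff hinj, ← hJm]
    exact image_mono (hexh t₁ ht₁)

/-- The ansatz (some `N`) is invariant under isometry of developments. -/
theorem ansatz_of_isIsometricTo {𝒟₁ 𝒟₂ : VacuumCauchyDevelopment D}
    (h : 𝒟₁.IsIsometricTo 𝒟₂.toCauchyDevelopment) (hA : Ansatz 𝒟₁) : Ansatz 𝒟₂ :=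
  let ⟨N, hN⟩ := hA; ⟨N, ansatzN_of_isIsometricTo h hN⟩

/-- **For MGHDs the `∀`-bundling of the ansatz costs nothing**: if ONE maximal vacuum Cauchy
development of `D` carries the ansatz then EVERY maximal one does (MGHD uniqueness up to isometry,
`mghd_unique_cauchy`, is a theorem of the tree). -/
theorem ansatz_forall_of_exists {𝒟₁ : VacuumCauchyDevelopment D} (h₁ : 𝒟₁.IsMaximal)
    (hA : Ansatz 𝒟₁) (𝒟₂ : VacuumCauchyDevelopment D) (h₂ : 𝒟₂.IsMaximal) : Ansatz 𝒟₂ :=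
  ansatz_of_isIsometricTo (mghd_unique_cauchy 𝒟₁ 𝒟₂ h₁ h₂) hA

end Invariance

/-! ### Consequences for the bundling `∃ MGHD ∧ ∀ MGHD` and for the trivial datum -/

section Bundling

variable {X : Type} [TopologicalSpace X] [ChartedSpace E3 X] [IsManifold (𝓡 3) ((⊤ : ℕ∞) : WithTop ℕ∞) X]
  [ConnectedSpace X] {D : InitialDataSet (𝓡 3) X}

/-- **The `∃ ∧ ∀` bundling of the crux is harmless modulo ONE standard fact.** Under
isometry-invariance of complete `𝓘⁺` among the maximal developments of `D` (the only missing
brick, cf. seat 9952's `CompleteNullInfinityInvariant`; the ansatz half IS invariant,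
`ansatz_of_isIsometricTo`), `AnsatzProp D` (rev 5) is equivalent to the existence of ONE maximal
development with complete `𝓘⁺` and the ansatz (rev-6 version: §14). -/
theorem ansatzProp_iff_exists_of_cni_invariant
    (hinv : ∀ 𝒟₁ 𝒟₂ : VacuumCauchyDevelopment D, 𝒟₁.IsMaximal → 𝒟₂.IsMaximal →
      Summit.FinalStateConjecture.HasCompleteNullInfinity 𝒟₁.toCauchyDevelopment →
        Summit.FinalStateConjecture.HasCompleteNullInfinity 𝒟₂.toCauchyDevelopment) :
    AnsatzProp X D ↔ ∃ 𝒟 : VacuumCauchyDevelopment D, 𝒟.IsMaximal ∧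
      Summit.FinalStateConjecture.HasCompleteNullInfinity 𝒟.toCauchyDevelopment ∧ Ansatz 𝒟 := by
  constructor
  · rintro ⟨⟨𝒟, h𝒟⟩, hall⟩
    exact ⟨𝒟, h𝒟, hall 𝒟 h𝒟⟩
  · rintro ⟨𝒟, h𝒟, hcni, hA⟩
    exact ⟨⟨𝒟, h𝒟⟩, fun 𝒟' h𝒟' ↦ ⟨hinv 𝒟 𝒟' h𝒟 h𝒟' hcni, ansatz_forall_of_exists h𝒟 hA 𝒟' h𝒟'⟩⟩

end Bundling

/-- **The trivial datum is GOOD for the rev-5 property modulo Minkowski maximality and `𝓘⁺`-invariance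
only** (the ansatz half of hypothesis (ii) of `trivialData_ansatzProp_of` is a theorem). -/
theorem trivialData_ansatzProp_of_cni_invariant (hmax : 𝒟₀.IsMaximal)
    (hinvCNI : ∀ 𝒟 : VacuumCauchyDevelopment trivialData, 𝒟₀.IsIsometricTo 𝒟.toCauchyDevelopment →
      Summit.FinalStateConjecture.HasCompleteNullInfinity 𝒟₀.toCauchyDevelopment →
        Summit.FinalStateConjecture.HasCompleteNullInfinity 𝒟.toCauchyDevelopment) :
    AnsatzProp Minkowski.slice trivialData :=
  ⟨⟨𝒟₀, hmax⟩, fun 𝒟 h𝒟 ↦ ⟨hinvCNI 𝒟 (mghd_unique_cauchy 𝒟₀ 𝒟 hmax h𝒟) minkowski_hasCompleteNullInfinity,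
    ansatz_forall_of_exists hmax ansatz_minkowski 𝒟 h𝒟⟩⟩


/-! ## §11 (NEW) The tame witness notion: what a witness must do, what a trap must defeat -/

section TameWitness

variable {E : Type*} [NormedAddCommGroup E] [NormedSpace ℝ E] {H : Type*} [TopologicalSpace H]
  {I : ModelWithCorners ℝ E H} {Y : Type*} [TopologicalSpace Y] [ChartedSpace H Y] [IsManifold I ∞ Y]

/-- **RECEDING-ONLY MODIFICATIONS ARE NOT IMMERSED** (landed: `Negative/LoadBearing.lean`, p134193;
independently `trimFlat_not_isImmersedAtZero` of ideator 2's sketch). If along `F : ℝᵐ → data`,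
`m ≠ 0`, every scalar component `c ↦ h_c(x)(u, w)`, `c ↦ k_c(x)(u, w)` at every point agrees with its
value at `c = 0` for all `c` near `0` (the neighbourhood may depend on the point — the signature of a
family modifying the base datum only on a set RECEDING to infinity as `c → 0`: tail trimming / Kerr-end
gluing at radius `R(c) → ∞`, far-out pulses), then `F` is not immersed at `0`. So pure far-field
surgery, which swallowed the tail strata of the retired crux (gen-2 §9 item 1), is no longer a witness by
itself: every tame witness of H′ moves the datum at first order somewhere at `c = 0`. -/
theorem not_isImmersedAtZero_of_eventuallyEq {m : ℕ} (hm : m ≠ 0)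
    {F : EuclideanSpace ℝ (Fin m) → InitialDataSet I Y}
    (hh : ∀ (x : Y) (u w : TangentSpace I x),
      (fun c ↦ (F c).h.inner x u w) =ᶠ[𝓝 0] fun _ ↦ (F 0).h.inner x u w)
    (hk : ∀ (x : Y) (u w : TangentSpace I x),
      (fun c ↦ (F c).k x u w) =ᶠ[𝓝 0] fun _ ↦ (F 0).k x u w) :
    ¬ InitialDataSet.IsImmersedAtZero m F := by
  intro himm
  obtain ⟨x, u, w, huw⟩ :=
    himm (EuclideanSpace.single ⟨0, Nat.pos_of_ne_zero hm⟩ 1) (by simp)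
  have h1 : fderiv ℝ (fun c ↦ (F c).h.inner x u w) 0 = 0 := by
    rw [(hh x u w).fderiv_eq]; exact fderiv_const_apply _
  have h2 : fderiv ℝ (fun c ↦ (F c).k x u w) 0 = 0 := by
    rw [(hk x u w).fderiv_eq]; exact fderiv_const_apply _
  rcases huw with h | h
  · exact h (by rw [h1]; rfl)
  · exact h (by rw [h2]; rfl)

end TameWitness

section Burial

variable {Y : Type} [TopologicalSpace Y] [ChartedSpace E3 Y] [IsManifold (𝓡 3) ((⊤ : ℕ∞) : WithTop ℕ∞) Y]

/-- **BURIAL IS NOT TAME** (sibling lane `WeakCosmicCensorshipTame/Negative/TameMassContinuity.lean`,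
`not_isTameDataFamily_of_mass_tendsto_atTop`): a family strongly asymptotically flat on the end `e`
whose masses tend to `+∞` along a sequence of parameters `cₙ → 0` is not tame on `e` — the exact-Kerr
burial families of route SwallowTheDatum (`M(c) ~ 1/|c|`), which closed the retired crux 10167
conditionally (line swallow-transfer), are not witnesses for H′. The mass is in fact CONTINUOUS at
`c = 0` along every tame family (`tendsto_mass_of_isTameDataFamily`): the one new trap-building
functional that tameness hands a refuter (§9 item 11). -/
theorem burial_not_tame {e : AFEnd Y} {m : ℕ} {F : EuclideanSpace ℝ (Fin m) → InitialDataSet (𝓡 3) Y}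
    {M : EuclideanSpace ℝ (Fin m) → ℝ} (hM : ∀ c, e.IsStronglyAsymptoticallyFlatDR (F c) (M c))
    {u : ℕ → EuclideanSpace ℝ (Fin m)} (hu : Tendsto u atTop (𝓝 0))
    (hdiv : Tendsto (M ∘ u) atTop atTop) : ¬ InitialDataSet.IsTameDataFamily e m F :=
  not_isTameDataFamily_of_mass_tendsto_atTop hM hu hdiv

/-- **TAME WITNESS CURVES EXIST THROUGH EVERY ADMISSIBLE DATUM** (Literature `exists_tame_selfWitness`:
the breathing curve — compactly supported pull-backs of `d` far out on its end): the witness notion of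
H′ (tame, immersed, injective, admissible) is satisfiable through every admissible `d`, so no refutation
comes from a datum admitting NO tame curve at all. Its members are isometric copies of `d` (same data
off a compact set, pulled back inside), hence have the same `HandoffProp`-status as `d` (a development
of `φ^* d` is a development of `d` re-embedded along `φ`): gauge families witness nothing, for provers
and refuters alike. -/
theorem exists_tame_family_through [T2Space Y] [SecondCountableTopology Y] [ConnectedSpace Y]
    {d : InitialDataSet (𝓡 3) Y} (hd : d ∈ admissibleVacuumData Y) :
    ∃ (e : AFEnd Y) (F : EuclideanSpace ℝ (Fin 1) → InitialDataSet (𝓡 3) Y),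
      InitialDataSet.IsTameDataFamily e 1 F ∧ InitialDataSet.IsImmersedAtZero 1 F ∧ F 0 = d ∧
        Injective F ∧ ∀ c, F c ∈ admissibleVacuumData Y := by
  obtain ⟨e, F, hF, himm, h0, hinj, hadm, -⟩ := InitialDataSet.exists_tame_selfWitness hd
  exact ⟨e, F, hF, himm, h0, hinj, hadm⟩

/-- **THE CODIMENSION SCALE: `m = 0` IS TRIVIAL** (sibling lane, `isTameChristodoulouGeneric_admissible_zero`;
landed for H′: `Negative/Readback.lean` `modulatedKerrHandoff_scale_zero`): with codimension parameter `0`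
in place of `1`, tame genericity of `HandoffProp` holds on every `Σ` (constant `ℝ⁰`-families). All
content of H′ sits at `m = 1`. -/
theorem modulatedKerrHandoff_scale_zero [T2Space Y] [SecondCountableTopology Y] [ConnectedSpace Y] :
    InitialDataSet.IsTameChristodoulouGeneric (admissibleVacuumData Y) (HandoffProp Y) 0 :=
  isTameChristodoulouGeneric_admissible_zero Y _

end Burial

/-! ## §12 (NEW) The four handoff clauses in the Minkowski model (`N = 0`): all sixteen clauses are
jointly satisfiable, with censorship, in a genuine vacuum development of an admissible datum -/

section HandoffMinkowski

/-- **(T) at `N = 0` in Minkowski space** (with `τ₁ = 0`): `J⁺(x) = {y | ‖y̲ − x̲‖ ≤ y⁰ − x⁰}`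
(`Minkowski.causalFuture_singleton`), so `x⁰ ≤ y⁰` along causal curves — lab time IS a time function. -/
theorem clauseT_minkowski (rin a : Fin 0 → ℝ) (Λ : Fin 0 → ℝ → lorentzGroup) (ξ : Fin 0 → ℝ → E3) :
    ∃ τ₁ : ℝ, ∀ x y : (⊤ : Opens E4), (τ₁ < x.1 0 ∧ ∀ i, rin i < Kerr.radius (a i) (poincareInv (Λ i (x.1 0)) (E4.ofTimeSpace (x.1 0) (ξ i (x.1 0))) x.1)) → (τ₁ < y.1 0 ∧ ∀ i, rin i < Kerr.radius (a i) (poincareInv (Λ i (y.1 0)) (E4.ofTimeSpace (y.1 0) (ξ i (y.1 0))) y.1)) → Φ₀ y ∈ 𝒟₀.metric.causalFuture 𝒟₀.timeOrientation {Φ₀ x} → x.1 0 ≤ y.1 0 := by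
  refine ⟨0, fun x y _ _ hxy ↦ ?_⟩
  have h := Minkowski.causalFuture_singleton (x : E4)
  have h' : toE4 (Φ₀ y) ∈ LorentzianMetric.causalFuture
      (LorentzianMetric.ofLE (n' := ((⊤ : ℕ∞) : WithTop ℕ∞)) Minkowski.metric le_top)
      (TimeOrientation.ofLE (n' := ((⊤ : ℕ∞) : WithTop ℕ∞)) Minkowski.timeOrientation le_top)
      {(x : E4)} := hxy
  rw [h] at h'
  have h'' : ‖E4.spatial (y : E4) - E4.spatial (x : E4)‖ ≤ (y : E4) 0 - (x : E4) 0 := by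
    simpa using h'
  linarith [norm_nonneg (E4.spatial (y : E4) - E4.spatial (x : E4))]

/-- **(O) at `N = 0`**: vacuous. -/
theorem clauseO_fin0 (Λ : Fin 0 → ℝ → lorentzGroup) :
    ∀ (i : Fin 0) (t : ℝ), 0 < (((Λ i t : lorentzGroup) : E4 ≃L[ℝ] E4) (E4.basisVector 0)) 0 :=
  fun i ↦ i.elim0

-- operator-norm instance paths on form-valued maps are slow to unify (clause (QS))
set_option synthInstance.maxHeartbeats 400000 in
/-- **(QS) at `N = 0`**: with NO centre the distance to the nearest centre is the junk `⨅ ∅ = 0`, so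
the constraint `ρ t ≤ 0` empties the sampled set as soon as `ρ t > 0` — eventually, since `ρ → ∞` —
and the weighted supremum is `⊥ = 0` from then on (the painted background is anyway the constant `η`).
So (QS) is vacuous at `N = 0`, exactly like (O). -/
theorem clauseQS_fin0 (M a : Fin 0 → ℝ) (Λ : Fin 0 → ℝ → lorentzGroup) (ξ : Fin 0 → ℝ → E3) (κ : ℝ) :
    ∀ ρ : ℝ → ℝ, Tendsto ρ atTop atTop → Tendsto (fun t : ℝ ↦ ⨆ x ∈ {x : E4 | x 0 = t ∧ E4.spatialNorm x ≤ κ * t ∧ ρ t ≤ ⨅ i, ‖E4.spatial x - ξ i t‖}, ENNReal.ofReal (1 + √(√((⨅ i, ‖E4.spatial x - ξ i t‖) ^ 7))) * ‖fderiv ℝ (fun y : E4 ↦ Minkowski.bilin + ∑ i, (boostedKerrBilin (Λ i (y 0)) (E4.ofTimeSpace (y 0) (ξ i (y 0))) (M i) (a i) y - Minkowski.bilin)) x (E4.basisVector 0)‖ₑ) atTop (𝓝 0) := by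
  intro ρ hρ
  refine tendsto_const_nhds.congr' ?_
  filter_upwards [hρ.eventually_gt_atTop 0] with t ht
  symm
  simp only [ENNReal.iSup_eq_zero]
  intro x hx
  exfalso
  have h3 := hx.2.2
  rw [Real.iInf_of_isEmpty] at h3
  linarith

/-- Points of `E4` with nonnegative time lie in the closure of the late half-space `L₀ = {x⁰ > 0}`
(approach `z` by `z + s e₀`, `s ↓ 0`). -/
theorem mem_closure_L₀ {z : E4} (hz : 0 ≤ z 0) : ofE4 z ∈ closure L₀ := by
  have hc : Continuous fun s : ℝ ↦ z + s • E4.basisVector 0 := by fun_prop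
  have hlim : Tendsto (fun s : ℝ ↦ z + s • E4.basisVector 0) (𝓝[>] 0) (𝓝 z) := by
    have h := hc.continuousAt (x := (0 : ℝ)) |>.tendsto
    simp only [zero_smul, add_zero] at h
    exact h.mono_left nhdsWithin_le_nhds
  refine mem_closure_of_tendsto (f := fun s : ℝ ↦ ofE4 (z + s • E4.basisVector 0))
    (b := 𝓝[>] (0 : ℝ)) hlim ?_
  filter_upwards [self_mem_nhdsWithin] with s hs
  refine ⟨⟨z + s • E4.basisVector 0, trivial⟩, ?_, rfl⟩
  show (0 : ℝ) < (z + s • E4.basisVector 0) 0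
  have : (z + s • E4.basisVector 0) 0 = z 0 + s := by simp [E4.basisVector]
  rw [this]
  exact add_pos_of_nonneg_of_pos hz hs

/-- **(R) at `N = 0` in Minkowski space: every normalised future null ray from the slice stays in
`closure O₀`.** A normalised null ray is a maximal geodesic of `η`; geodesics of `η` are straight lines
defined on `ℝ` (`ModelSpace.isGeodesic_line`, uniqueness `IsGeodesicOn.eqOn_of_velocity_eq_holds`), so
`γ(t) = ι p + t v` with `v⁰ = 1` by the normalisation `η(v, ∂ₜ) = −1`; hence `(γ t)⁰ = t ≥ 0`, and
`{x⁰ ≥ 0} ⊆ closure L₀ ⊆ closure O₀` (`L₀_subset_O₀`, `mem_closure_L₀`). -/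
theorem raysStayInClosure_O₀ :
    Summit.FinalStateConjecture.RaysStayInClosure 𝒟₀.toCauchyDevelopment O₀ := by
  intro hLC p γ dom hray _hunb t ht ht0
  haveI : Minkowski.smoothMetric.toPseudoRiemannianMetric.HasLeviCivita := hLC
  haveI : CovariantDerivative.ContMDiffCovariantDerivative
      𝒟₀.metric.toPseudoRiemannianMetric.leviCivita 1 :=
    ⟨𝒟₀.metric.toPseudoRiemannianMetric.isLocallyContMDiff_leviCivita_holds
      1 (by rw [show ((1 : ℕ∞) : ℕ∞ω) + 1 = 2 by norm_num]; exact WithTop.coe_le_coe.2 le_top)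
      univ isOpen_univ⟩
  obtain ⟨hmax, h0, hγ0, -, -, hnorm⟩ := hray
  set x₀ : E4 := toE4 (γ 0) with hx₀
  set v : E4 := (velocity (𝓡 4) γ 0 : E4) with hv
  -- the straight line with the same initial data is a geodesic on `ℝ`
  have hline : IsGeodesic 𝒟₀.metric.toPseudoRiemannianMetric.leviCivita
      (fun s : ℝ ↦ ofE4 (x₀ + s • v)) :=
    ModelSpace.isGeodesic_line (g := Minkowski.smoothMetric.toPseudoRiemannianMetric)
      (G₀ := Minkowski.bilin) Minkowski.smoothMetric_val x₀ v
  have hl0 : γ 0 = (fun s : ℝ ↦ ofE4 (x₀ + s • v)) 0 := by simp [hx₀]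
  have hlv : velocity (𝓡 4) γ 0 = velocity (𝓡 4) (fun s : ℝ ↦ ofE4 (x₀ + s • v)) 0 := by
    rw [show velocity (𝓡 4) (fun s : ℝ ↦ ofE4 (x₀ + s • v)) 0 = v from ModelSpace.velocity_line x₀ v 0]
  have heq : EqOn γ (fun s : ℝ ↦ ofE4 (x₀ + s • v)) dom :=
    IsGeodesicOn.eqOn_of_velocity_eq_holds hmax.isOpen hmax.2.1 hmax.isGeodesicOn
      ((hline.isGeodesicOn univ).mono (subset_univ _)) h0 hl0 hlv
  -- normalisation: `v⁰ = 1`; base point on the slice: `x₀⁰ = 0`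
  have hv0 : v 0 = 1 := by
    have h1 : Minkowski.bilin v (E4.basisVector 0) = -1 := by
      have h2 := hnorm
      rw [Minkowski.vacuumCauchyDevelopment_normal, Minkowski.sliceNormal_apply] at h2
      exact h2
    rw [Minkowski.bilin_symm, Minkowski.bilin_basisVector_zero_left] at h1
    linarith
  have hx00 : x₀ 0 = 0 := by
    rw [hx₀, hγ0, Minkowski.vacuumCauchyDevelopment_embed, Minkowski.sliceEmbed_apply]
    simp
  have hγt : toE4 (γ t) 0 = t := by
    rw [heq ht]
    show (x₀ + t • v) 0 = t
    simp [hx00, hv0]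
  exact closure_mono L₀_subset_O₀ (mem_closure_L₀ (z := toE4 (γ t)) (by rw [hγt]; exact ht0))

-- operator-norm instance paths on form-valued maps are slow to unify (clause (QS))
set_option synthInstance.maxHeartbeats 400000 in
/-- **BOUNDARY LEMMA (rev 6), core.** All SIXTEEN clauses of the modulated ansatz with handoff for the
Minkowski development with NO hole — `γ = 1`, `κ = 1/2`, `τ₀ = 0`, `U = ⊤`, `Φ = id`,
`O = J⁺({t=0}) ∩ I⁻({t>0})` — for any (empty) families of hole parameters and any background bilinear
field `b` equal to `η` (the crux's `let B` for `N = 0`): the twelve of `ansatz_clauses_minkowski` plus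
(T) `clauseT_minkowski`, (O) vacuous, (R) `raysStayInClosure_O₀`, (QS) `clauseQS_fin0`. -/
theorem handoff_clauses_minkowski (M a rin : Fin 0 → ℝ) (Λ : Fin 0 → ℝ → lorentzGroup)
    (ξ : Fin 0 → ℝ → E3) (b : E4 → E4 →L[ℝ] E4 →L[ℝ] ℝ) (hb : b = fun _ ↦ Minkowski.bilin) :
    (∀ i, Kerr.IsSubextremal (M i) (a i) ∧ Kerr.rMinus (M i) (a i) < rin i ∧ rin i < Kerr.rPlus (M i) (a i)) ∧ (∀ i t, |((Λ i t : E4 ≃L[ℝ] E4) (E4.basisVector 0)) 0| ≤ (1 : ℝ)) ∧ (∀ i, ContDiff ℝ ((⊤ : ℕ∞) : WithTop ℕ∞) (ξ i) ∧ ContDiff ℝ ((⊤ : ℕ∞) : WithTop ℕ∞) (fun t ↦ ((Λ i t : E4 ≃L[ℝ] E4) : E4 →L[ℝ] E4))) ∧ (∀ i j, i ≠ j → Tendsto (fun t ↦ ‖ξ i t - ξ j t‖) atTop atTop) ∧ ((0 : ℝ) < 1 / 2 ∧ (1 / 2 : ℝ) < 1 ∧ ∀ i, ∀ᶠ t in atTop,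 ‖ξ i t‖ ≤ (1 / 2 : ℝ) ^ 2 * t) ∧ ({x : E4 | (0 : ℝ) < x 0 ∧ ∀ i, rin i < Kerr.radius (a i) (poincareInv (Λ i (x 0)) (E4.ofTimeSpace (x 0) (ξ i (x 0))) x)} ⊆ ((⊤ : Opens E4) : Set E4)) ∧ let B : ModelBackground := ⟨⊤, b, fun x ↦ x 0, E4.spatialNorm⟩; ContMDiff 𝓘(ℝ, E4) (𝓡 4) ((⊤ : ℕ∞) : WithTop ℕ∞) Φ₀ ∧ Topology.IsOpenEmbedding ((B.lateRegion 0).restrict Φ₀) ∧ Φ₀ '' {x : (⊤ : Opens E4) | (0 : ℝ) < x.1 0 ∧ ∀ i, Kerr.rPlus (M i) (a i) < Kerr.radius (a i) (poincareInv (Λ i (x.1 0)) (E4.ofTimeSpace (x.1 0) (ξ i (x.1 0))) x.1)} ⊆ O₀ ∧ Tendsto (fun t ↦ 𝒟₀.toSpacetime.deviationCk B Φ₀ 3 t) atTop (𝓝 0) ∧ Tendsto (fun t : ℝ ↦ ⨆ x ∈ {x : (⊤ : Opens E4) | x.1 0 = t ∧ E4.spatialNorm x.1 ≤ 1 / 2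 * t}, ⨆ (m : ℕ) (_ : m ≤ 3), ENNReal.ofReal (1 + √(√((⨅ i, ‖E4.spatial x.1 - ξ i t‖) ^ 7))) * ‖iteratedFDeriv ℝ m (𝒟₀.toSpacetime.deviationExtend B Φ₀) x.1‖ₑ) atTop (𝓝 0) ∧ O₀ = Summit.FinalStateConjecture.exteriorOf 𝒟₀.toCauchyDevelopment (Φ₀ '' {x : (⊤ : Opens E4) | (0 : ℝ) < x.1 0 ∧ ∀ i, Kerr.rPlus (M i) (a i) < Kerr.radius (a i) (poincareInv (Λ i (x.1 0)) (E4.ofTimeSpace (x.1 0) (ξ i (x.1 0))) x.1)}) ∧ (∀ t₁ : ℝ, (0 : ℝ) < t₁ → O₀ \ Φ₀ '' {x : (⊤ : Opens E4) | t₁ < x.1 0 ∧ ∀ i, Kerr.rPlus (M i) (a i) < Kerr.radius (a i) (poincareInv (Λ i (x.1 0)) (E4.ofTimeSpace (x.1 0) (ξ i (x.1 0))) x.1)} ⊆ 𝒟₀.metric.causalPast 𝒟₀.timeOrientation (Φ₀ '' {x : (⊤ : Opens E4) | x.1 0 = t₁ ∧ ∀ i, Kerr.rPlus (M i) (a i)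 < Kerr.radius (a i) (poincareInv (Λ i (x.1 0)) (E4.ofTimeSpace (x.1 0) (ξ i (x.1 0))) x.1)})) ∧ (∃ τ₁ : ℝ, ∀ x y : (⊤ : Opens E4), (τ₁ < x.1 0 ∧ ∀ i, rin i < Kerr.radius (a i) (poincareInv (Λ i (x.1 0)) (E4.ofTimeSpace (x.1 0) (ξ i (x.1 0))) x.1)) → (τ₁ < y.1 0 ∧ ∀ i, rin i < Kerr.radius (a i) (poincareInv (Λ i (y.1 0)) (E4.ofTimeSpace (y.1 0) (ξ i (y.1 0))) y.1)) → Φ₀ y ∈ 𝒟₀.metric.causalFuture 𝒟₀.timeOrientation {Φ₀ x} → x.1 0 ≤ y.1 0) ∧ (∀ (i : Fin 0) (t : ℝ), 0 < (((Λ i t : lorentzGroup) : E4 ≃L[ℝ] E4) (E4.basisVector 0)) 0) ∧ Summit.FinalStateConjecture.RaysStayInClosure 𝒟₀.toCauchyDevelopment O₀ ∧ (∀ ρ : ℝ → ℝ, Tendsto ρ atTop atTop → Tendsto (fun t : ℝ ↦ ⨆ x ∈ {x : E4 | x 0 = t ∧ E4.spatialNorm x ≤ 1 / 2 * t ∧ ρ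 t ≤ ⨅ i, ‖E4.spatial x - ξ i t‖}, ENNReal.ofReal (1 + √(√((⨅ i, ‖E4.spatial x - ξ i t‖) ^ 7))) * ‖fderiv ℝ (fun y : E4 ↦ Minkowski.bilin + ∑ i, (boostedKerrBilin (Λ i (y 0)) (E4.ofTimeSpace (y 0) (ξ i (y 0))) (M i) (a i) y - Minkowski.bilin)) x (E4.basisVector 0)‖ₑ) atTop (𝓝 0)) := by
  obtain ⟨h1, h2, h3, h4, h5, h6, hB⟩ := ansatz_clauses_minkowski M a rin Λ ξ b hb
  refine ⟨h1, h2, h3, h4, h5, h6, ?_⟩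
  obtain ⟨h7, h8, h9, h10, h10', h11, h12⟩ := hB
  exact ⟨h7, h8, h9, h10, h10', h11, h12, clauseT_minkowski rin a Λ ξ, clauseO_fin0 Λ,
    raysStayInClosure_O₀, clauseQS_fin0 M a Λ ξ (1 / 2)⟩

/-- **BOUNDARY LEMMA (rev 6) — Minkowski space satisfies the modulated ansatz WITH HANDOFF, `N = 0`**
(the literal `∃`-block of H′, `HandoffN … 0`, for `Minkowski.vacuumCauchyDevelopment`). -/
theorem handoffN_zero_minkowski : HandoffN 𝒟₀ 0 :=
  ⟨Fin.elim0, Fin.elim0, Fin.elim0, Fin.elim0, Fin.elim0, 1, 1 / 2, 0, ⊤, Φ₀, O₀,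
    handoff_clauses_minkowski _ _ _ _ _ _ (bilin_add_sum_fin_zero _)⟩

/-- The ansatz-with-handoff clause of H′ holds for the Minkowski development (with `N = 0`). -/
theorem handoff_minkowski : Handoff 𝒟₀ := ⟨0, handoffN_zero_minkowski⟩

/-- **The per-development CONCLUSION of H′ — complete `𝓘⁺` (sojourn form) AND the sixteen-clause
modulated ansatz with handoff — holds for a genuine vacuum Cauchy development of an admissible datum**:
Minkowski space over `(ℝ³, δ, 0)`. ANTI-VACUITY / ANTI-CONTRADICTION CERTIFICATE for the re-typed crux:
no refutation can come from an internal inconsistency of the conclusion (which, the admissible class of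
`ℝ³` being nonempty, would have killed H′ outright by `not_modulatedKerrHandoff_of_forall_not`). -/
theorem conclusion'_minkowski :
    Summit.FinalStateConjecture.HasCompleteNullInfinity 𝒟₀.toCauchyDevelopment ∧ Handoff 𝒟₀ :=
  ⟨minkowski_hasCompleteNullInfinity, handoff_minkowski⟩

/-- NEAR-MISS MADE PRECISE (rev 6): the trivial datum HAS `HandoffProp` — hence the pointwise road
"every admissible datum on `ℝ³` is exceptional" to a kill of H′ is CLOSED — modulo (i) MAXIMALITY of the
Minkowski development among vacuum Cauchy developments of `(ℝ³, δ, 0)` and (ii) invariance of the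
conclusion under isometry of developments (for the sixteen clauses other than (R) and complete `𝓘⁺`
this invariance is PROVED, §14). -/
theorem trivialData_handoffProp_of (hmax : 𝒟₀.IsMaximal)
    (hinv : ∀ 𝒟 : VacuumCauchyDevelopment trivialData, 𝒟₀.IsIsometricTo 𝒟.toCauchyDevelopment →
      (Summit.FinalStateConjecture.HasCompleteNullInfinity 𝒟₀.toCauchyDevelopment ∧ Handoff 𝒟₀) →
        (Summit.FinalStateConjecture.HasCompleteNullInfinity 𝒟.toCauchyDevelopment ∧ Handoff 𝒟)) :
    HandoffProp Minkowski.slice trivialData :=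
  ⟨⟨𝒟₀, hmax⟩, fun 𝒟 h𝒟 ↦ hinv 𝒟 (mghd_unique_cauchy 𝒟₀ 𝒟 hmax h𝒟) conclusion'_minkowski⟩

end HandoffMinkowski

/-! ## §13 (NEW) Rigidity of (O): orthochronicity is decided at one instant -/

section ClauseO

open Summit.FinalStateConjecture.FinalStateConjecture.Theorems (one_le_abs_lorentz_apply_zero)

/-- **(O) FOR ALL `t` IS (O) AT ONE INSTANT, given the continuity in clause (3).** The Lorentz factor
`(Λ(t)e₀)⁰` of `Λ(t) ∈ O(1,3)` has absolute value `≥ 1` (`one_le_abs_lorentz_apply_zero`) and depends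
continuously on `t`, so by the intermediate value theorem its sign is constant on `ℝ`: the painted frame
of a hole is orthochronous at all lab times iff it is at `t = 0`. (So the clause could be weakened to one
instant with no loss; and conversely a prover cannot repair a time-reversed painting late: the sign is
fixed by the choice at any one time.) -/
theorem clauseO_iff_at_zero {Λ : ℝ → lorentzGroup}
    (hΛ : Continuous fun t ↦ ((Λ t : E4 ≃L[ℝ] E4) : E4 →L[ℝ] E4)) :
    (∀ t, 0 < ((Λ t : E4 ≃L[ℝ] E4) (E4.basisVector 0)) 0) ↔
      0 < ((Λ 0 : E4 ≃L[ℝ] E4) (E4.basisVector 0)) 0 := by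
  refine ⟨fun h ↦ h 0, fun h0 t ↦ ?_⟩
  set f : ℝ → ℝ := fun s ↦ ((Λ s : E4 ≃L[ℝ] E4) (E4.basisVector 0)) 0 with hf
  have hfc : Continuous f := by
    have h1 : Continuous fun s ↦ ((Λ s : E4 ≃L[ℝ] E4) : E4 →L[ℝ] E4) (E4.basisVector 0) :=
      hΛ.clm_apply continuous_const
    exact (EuclideanSpace.proj (0 : Fin 4)).continuous.comp h1
  by_contra hle
  push Not at hle
  have hsub : Icc (f t) (f 0) ⊆ range f := intermediate_value_univ t 0 hfc
  obtain ⟨s, hs⟩ := hsub ⟨hle, h0.le⟩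
  have h1 := one_le_abs_lorentz_apply_zero (Λ s)
  have h2 : ((Λ s : E4 ≃L[ℝ] E4) (E4.basisVector 0)) 0 = 0 := hs
  rw [h2, abs_zero] at h1
  linarith

/-- With (O), the Lorentz-factor bound (2) reads `1 ≤ (Λᵢ(t)e₀)⁰ ≤ γ` (in particular `γ ≥ 1` as soon
as `N ≠ 0`). -/
theorem one_le_of_clauseO {Λ : lorentzGroup} (h : 0 < ((Λ : E4 ≃L[ℝ] E4) (E4.basisVector 0)) 0) :
    1 ≤ ((Λ : E4 ≃L[ℝ] E4) (E4.basisVector 0)) 0 := by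
  have := one_le_abs_lorentz_apply_zero Λ
  rwa [abs_of_pos h] at this

end ClauseO

/-! ## §14 (NEW) Transport of the sixteen clauses under isometry of developments, modulo (R)-invariance -/

section HandoffTransport

variable {X : Type} [TopologicalSpace X] [ChartedSpace E3 X] [IsManifold (𝓡 3) ((⊤ : ℕ∞) : WithTop ℕ∞) X]
  [ConnectedSpace X] {D : InitialDataSet (𝓡 3) X}

/-- **INVARIANCE OF `RaysStayInClosure` UNDER ISOMETRY OF DEVELOPMENTS** (the one brick of the
sixteen-clause transport not proved here: it needs naturality of Levi-Civita null geodesics and of the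
normalisation under time-orientation preserving isometries commuting with the data embeddings —
standard, absent from the tree like `CompleteNullInfinityInvariant` of seat 9952). -/
def RaysStayInClosureTransport (D : InitialDataSet (𝓡 3) X) : Prop :=
  ∀ (𝒟₁ 𝒟₂ : VacuumCauchyDevelopment D)
    (ψ : Diffeomorph (𝓡 4) (𝓡 4) 𝒟₁.carrier 𝒟₂.carrier ((⊤ : ℕ∞) : WithTop ℕ∞)),
    𝒟₁.metric.IsIsometry 𝒟₂.metric.toPseudoRiemannianMetric ψ →
      𝒟₁.timeOrientation.PreservesTimeOrientation ψ 𝒟₂.timeOrientation → ψ ∘ 𝒟₁.embed = 𝒟₂.embed →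
        ∀ O : Set 𝒟₁.carrier, Summit.FinalStateConjecture.RaysStayInClosure 𝒟₁.toCauchyDevelopment O →
          Summit.FinalStateConjecture.RaysStayInClosure 𝒟₂.toCauchyDevelopment (ψ '' O)

/-- **THE SIXTEEN-CLAUSE ANSATZ WITH HANDOFF IS INVARIANT UNDER ISOMETRY OF DEVELOPMENTS, modulo
(R)-invariance** (`RaysStayInClosureTransport`). Same parameters, lab chart `ψ ∘ Φ`, exterior `ψ(O)`;
the deviation is unchanged, `ψ` transports `J^±`, `I^±`, the Cauchy surface and set differences
(clauses (7)–(12) as in `ansatzN_of_isIsometricTo`); (T) is transported because `ψ` carries `J⁺{Φ x}`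
onto `J⁺{ψ Φ x}` bijectively; (O) and (QS) mention the painted moduli only. -/
theorem handoffN_of_isIsometricTo_of (hRT : RaysStayInClosureTransport D)
    {𝒟₁ 𝒟₂ : VacuumCauchyDevelopment D}
    (h : 𝒟₁.IsIsometricTo 𝒟₂.toCauchyDevelopment) {N : ℕ} (hA : HandoffN 𝒟₁ N) : HandoffN 𝒟₂ N := by
  obtain ⟨ψ, hiso, hτ, hι⟩ := h
  -- standard facts about `ψ` and `ψ⁻¹`
  have hψd : MDifferentiable (𝓡 4) (𝓡 4) ψ := ψ.contMDiff.mdifferentiable (by simp)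
  have hψsd : MDifferentiable (𝓡 4) (𝓡 4) ψ.symm := ψ.symm.contMDiff.mdifferentiable (by simp)
  have hid : (ψ : 𝒟₁.carrier → 𝒟₂.carrier) ∘ ψ.symm = id := funext ψ.apply_symm_apply
  have hψ : ∀ y, pullbackBilin (I := 𝓡 4) (I' := 𝓡 4) ψ 𝒟₂.metric.val y = 𝒟₁.metric.val y := hiso
  have hiso' : ∀ z, pullbackBilin (I := 𝓡 4) (I' := 𝓡 4) ψ.symm 𝒟₁.metric.val z = 𝒟₂.metric.val z := by
    intro z
    have h1 : 𝒟₁.metric.val = pullbackBilin (I := 𝓡 4) (I' := 𝓡 4) ψ 𝒟₂.metric.val :=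
      (funext hiso).symm
    rw [h1, ← pullbackBilin_comp hψd hψsd, hid, pullbackBilin_id]
  have hkey : ∀ (z : 𝒟₂.carrier) (w : TangentSpace (𝓡 4) z),
      mfderiv (𝓡 4) (𝓡 4) ψ (ψ.symm z) (mfderiv (𝓡 4) (𝓡 4) ψ.symm z w) = w := by
    intro z w
    have h := mfderiv_comp z (hψd (ψ.symm z)) (hψsd z)
    rw [hid, mfderiv_id] at h
    exact (congrArg (fun L ↦ L w) h).symm
  have hτ' : 𝒟₂.timeOrientation.PreservesTimeOrientation ψ.symm 𝒟₁.timeOrientation := by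
    intro z
    refine hτ.isFutureDirected_of_mfderiv hiso ?_
    rw [hkey, ψ.apply_symm_apply]
    exact 𝒟₂.timeOrientation.isFutureDirected_vectorField z
  have hinj : Injective (ψ : 𝒟₁.carrier → 𝒟₂.carrier) := ψ.injective
  have hsymm_image : ∀ S : Set 𝒟₁.carrier, ψ.symm '' (ψ '' S) = S := fun S ↦ by
    rw [image_image]; simp
  -- transport of causal/chronological futures and pasts as EQUALITIES
  have hJp : ∀ S : Set 𝒟₁.carrier, ψ '' 𝒟₁.metric.causalFuture 𝒟₁.timeOrientation S =
      𝒟₂.metric.causalFuture 𝒟₂.timeOrientation (ψ '' S) := fun S ↦ by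
    refine Subset.antisymm (LorentzianMetric.image_causalFuture_subset hψd hτ hψ S) fun q hq ↦ ?_
    have h1 := LorentzianMetric.image_causalFuture_subset hψsd hτ' hiso' (ψ '' S)
      (mem_image_of_mem ψ.symm hq)
    rw [hsymm_image] at h1
    exact ⟨ψ.symm q, h1, ψ.apply_symm_apply q⟩
  have hJm : ∀ S : Set 𝒟₁.carrier, ψ '' 𝒟₁.metric.causalPast 𝒟₁.timeOrientation S =
      𝒟₂.metric.causalPast 𝒟₂.timeOrientation (ψ '' S) := fun S ↦ by
    refine Subset.antisymm (LorentzianMetric.image_causalPast_subset hψd hτ hψ S) fun q hq ↦ ?_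
    have h1 := LorentzianMetric.image_causalPast_subset hψsd hτ' hiso' (ψ '' S)
      (mem_image_of_mem ψ.symm hq)
    rw [hsymm_image] at h1
    exact ⟨ψ.symm q, h1, ψ.apply_symm_apply q⟩
  have hIm : ∀ S : Set 𝒟₁.carrier, ψ '' 𝒟₁.metric.chronologicalPast 𝒟₁.timeOrientation S =
      𝒟₂.metric.chronologicalPast 𝒟₂.timeOrientation (ψ '' S) := fun S ↦ by
    refine Subset.antisymm (image_chronologicalPast_subset hψd hτ hψ S) fun q hq ↦ ?_
    have h1 := image_chronologicalPast_subset hψsd hτ' hiso' (ψ '' S) (mem_image_of_mem ψ.symm hq)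
    rw [hsymm_image] at h1
    exact ⟨ψ.symm q, h1, ψ.apply_symm_apply q⟩
  have hrange : range 𝒟₂.embed = ψ '' range 𝒟₁.embed := by
    rw [← hι, Set.range_comp]
  -- unpack the ansatz of `𝒟₁`
  obtain ⟨Mh, a, rin, Λ, ξ, γ, κ, τ₀, U, Φ, O, h1, h2, h3, h4, h5, hU, hB⟩ := hA
  obtain ⟨hΦ, hemb, himO, hdev, hwt, hO, hexh, hT, hOc, hRay, hQS⟩ := hB
  have hΦd : MDifferentiable 𝓘(ℝ, E4) (𝓡 4) Φ := hΦ.mdifferentiable (by simp)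
  refine ⟨Mh, a, rin, Λ, ξ, γ, κ, τ₀, U, ψ ∘ Φ, ψ '' O, h1, h2, h3, h4, h5, hU, ?_⟩
  -- the deviation is unchanged (for every background on the chart domain `U`)
  have hdevEq : ∀ (b : E4 → E4 →L[ℝ] E4 →L[ℝ] ℝ) (tf rf : E4 → ℝ),
      𝒟₂.toSpacetime.deviationExtend ⟨U, b, tf, rf⟩ (ψ ∘ Φ) =
        𝒟₁.toSpacetime.deviationExtend ⟨U, b, tf, rf⟩ Φ := by
    intro b tf rf
    unfold Spacetime.deviationExtend
    rw [Spacetime.deviation_comp ⟨U, b, tf, rf⟩ hψd hψ hΦd]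
  have hCkEq : ∀ (b : E4 → E4 →L[ℝ] E4 →L[ℝ] ℝ) (tf rf : E4 → ℝ) (k : ℕ) (t : ℝ),
      𝒟₂.toSpacetime.deviationCk ⟨U, b, tf, rf⟩ (ψ ∘ Φ) k t =
        𝒟₁.toSpacetime.deviationCk ⟨U, b, tf, rf⟩ Φ k t := by
    intro b tf rf k t
    unfold Spacetime.deviationCk
    rw [hdevEq b tf rf]
  refine ⟨ψ.contMDiff.comp hΦ, ψ.toHomeomorph.isOpenEmbedding.comp hemb, ?_, ?_, ?_, ?_, ?_, ?_, hOc,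
    hRT 𝒟₁ 𝒟₂ ψ hiso hτ hι O hRay, hQS⟩
  · -- (9) late exterior image inside `ψ(O)`
    rw [image_comp]
    exact image_mono himO
  · -- (10) unweighted deviation
    simpa only [hCkEq] using hdev
  · -- (10') weighted deviation
    simpa only [hdevEq] using hwt
  · -- (11) the self-determined exterior is transported
    rw [hO, image_comp]
    unfold Summit.FinalStateConjecture.exteriorOf
    rw [image_inter hinj, hJp, hIm, hrange]
  · -- (12) exhaustion is transported
    intro t₁ ht₁
    rw [image_comp, image_comp, ← image_sdiff hinj, ← hJm]
    exact image_mono (hexh t₁ ht₁)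
  · -- (T) lab-time causality is transported
    obtain ⟨τ₁, hT⟩ := hT
    refine ⟨τ₁, fun x y hx hy hxy ↦ hT x y hx hy ?_⟩
    have h1 : ψ (Φ y) ∈ ψ '' 𝒟₁.metric.causalFuture 𝒟₁.timeOrientation {Φ x} := by
      rw [hJp, image_singleton]
      exact hxy
    obtain ⟨z, hz, hzq⟩ := h1
    rwa [← hinj hzq]


/-- The ansatz with handoff (some `N`) is invariant under isometry of developments, modulo
(R)-invariance. -/
theorem handoff_of_isIsometricTo_of (hRT : RaysStayInClosureTransport D)
    {𝒟₁ 𝒟₂ : VacuumCauchyDevelopment D} (h : 𝒟₁.IsIsometricTo 𝒟₂.toCauchyDevelopment)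
    (hA : Handoff 𝒟₁) : Handoff 𝒟₂ :=
  let ⟨N, hN⟩ := hA; ⟨N, handoffN_of_isIsometricTo_of hRT h hN⟩

/-- **For MGHDs the `∀`-bundling of the sixteen clauses costs nothing, modulo (R)-invariance**: if ONE
maximal vacuum Cauchy development of `D` carries the ansatz with handoff then EVERY maximal one does
(MGHD uniqueness up to isometry, `mghd_unique_cauchy`, is a theorem of the tree). -/
theorem handoff_forall_of_exists_of (hRT : RaysStayInClosureTransport D)
    {𝒟₁ : VacuumCauchyDevelopment D} (h₁ : 𝒟₁.IsMaximal) (hA : Handoff 𝒟₁)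
    (𝒟₂ : VacuumCauchyDevelopment D) (h₂ : 𝒟₂.IsMaximal) : Handoff 𝒟₂ :=
  handoff_of_isIsometricTo_of hRT (mghd_unique_cauchy 𝒟₁ 𝒟₂ h₁ h₂) hA

/-- **The `∃ ∧ ∀` bundling of H′ is harmless modulo TWO standard invariance facts** (complete `𝓘⁺`
and (R) under isometry of developments): `HandoffProp D` is then equivalent to the existence of ONE
maximal development with complete `𝓘⁺` and the sixteen clauses. -/
theorem handoffProp_iff_exists_of_invariant
    (hinv : ∀ 𝒟₁ 𝒟₂ : VacuumCauchyDevelopment D, 𝒟₁.IsMaximal → 𝒟₂.IsMaximal →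
      Summit.FinalStateConjecture.HasCompleteNullInfinity 𝒟₁.toCauchyDevelopment →
        Summit.FinalStateConjecture.HasCompleteNullInfinity 𝒟₂.toCauchyDevelopment)
    (hRT : RaysStayInClosureTransport D) :
    HandoffProp X D ↔ ∃ 𝒟 : VacuumCauchyDevelopment D, 𝒟.IsMaximal ∧
      Summit.FinalStateConjecture.HasCompleteNullInfinity 𝒟.toCauchyDevelopment ∧ Handoff 𝒟 := by
  constructor
  · rintro ⟨⟨𝒟, h𝒟⟩, hall⟩
    exact ⟨𝒟, h𝒟, hall 𝒟 h𝒟⟩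
  · rintro ⟨𝒟, h𝒟, hcni, hA⟩
    exact ⟨⟨𝒟, h𝒟⟩, fun 𝒟' h𝒟' ↦ ⟨hinv 𝒟 𝒟' h𝒟 h𝒟' hcni, handoff_forall_of_exists_of hRT h𝒟 hA 𝒟' h𝒟'⟩⟩

/-- **The trivial datum is GOOD for H′ modulo Minkowski maximality, `𝓘⁺`-invariance and
(R)-invariance** — the three standard facts separating the tree from closing road (β) of §9 item 13 at
the model point. -/
theorem trivialData_handoffProp_of_invariant (hmax : 𝒟₀.IsMaximal)
    (hinvCNI : ∀ 𝒟 : VacuumCauchyDevelopment trivialData, 𝒟₀.IsIsometricTo 𝒟.toCauchyDevelopment →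
      Summit.FinalStateConjecture.HasCompleteNullInfinity 𝒟₀.toCauchyDevelopment →
        Summit.FinalStateConjecture.HasCompleteNullInfinity 𝒟.toCauchyDevelopment)
    (hRT : RaysStayInClosureTransport trivialData) :
    HandoffProp Minkowski.slice trivialData :=
  ⟨⟨𝒟₀, hmax⟩, fun 𝒟 h𝒟 ↦ ⟨hinvCNI 𝒟 (mghd_unique_cauchy 𝒟₀ 𝒟 hmax h𝒟) minkowski_hasCompleteNullInfinity,
    handoff_forall_of_exists_of hRT hmax handoff_minkowski 𝒟 h𝒟⟩⟩

end HandoffTransport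

end Summit.FinalStateConjecture.FinalStateConjecture.Cruxes.ModulatedKerrHandoff.Disproof

end
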